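/-
Copyright (c) 2026. Released under Apache 2.0 license.
-/
import Literature.NumberTheory.EllipticCurves.ModularCurveEtaMultiplierProofs
import Literature.NumberTheory.EllipticCurves.ModularCurveGenusTwoProofs

/-!
# `η`-quotients on `Γ₀(N)` (Newman–Ligozat) and `dim S₂(Γ₀(N)) = g(X₀(N))` at ten more levels

An **`η`-quotient** of level `N` is `f(τ) = ∏_{δ ∣ N} η(δτ)^{r_δ}` (`r_δ ∈ ℤ`), of weight
`k = ½ Σ r_δ`. Newman's theorem (Newman 1957/1959; we follow the statement printed as Thm. 1 of
Savitt 2025) says that `f` is weakly modular of weight `k` on `Γ₀(N)` with character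
`d ↦ ((-1)^k s/d)`, `s = ∏ δ^{r_δ}`, as soon as

  `Σ δ r_δ ≡ 0 (mod 24)` and `Σ (N/δ) r_δ ≡ 0 (mod 24)`,

and (Ligozat; Savitt 2025, Rem. 2) the expansion of `f|_k γ` at the cusp determined by the
lower-left entry `c` of `γ ∈ SL₂(ℤ)` starts with `q^{(1/24) Σ_δ gcd(c,δ)² r_δ/δ}`, so that `f` is a
cusp form iff these orders are positive for all `c ∣ N`. We prove the sufficiency statements needed
to **construct cusp forms**: for `k` even and `s` a perfect square (trivial character),

* `etaQuotient_smul_of_mem_Gamma0`: `f(γτ) = (cτ + d)^k f(τ)` for all `γ ∈ Γ₀(N)`;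
* `isZeroAtImInfty_etaQuotient_slash`: `f|_k γ → 0` at `i∞` for every `γ ∈ SL₂(ℤ)` with
  `Σ_δ r_δ gcd(δ, c)² (N/δ) > 0` (`cuspOrder24`);
* `etaQuotientCuspForm`: the resulting element of `S_k(Γ₀(N))`;

and deduce `dim S₂(Γ₀(N)) = g(X₀(N))` (the named fact `finrank_cuspForm_two_eq_genusX0 N` of
`ModularCurve`, Diamond–Shurman Thm. 3.5.1) for the ten levels
`N = 14, 15, 24, 28, 30, 33, 35, 46, 54, 64` (genera `1, 1, 1, 2, 3, 3, 3, 5, 4, 3`), where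
`g(X₀(N))` weight-`2` `η`-quotients with pairwise distinct orders at `∞` exist: they are linearly
independent (`linearIndependent_of_tendsto_div_qParam_zpow`), which with Manin's bound
`dim ≤ g` (`finrank_cuspForm_two_le_genusX0`) gives equality. The hypotheses at each level are a
decidable certificate (`EtaCert`, checked by `decide`). Together with `ModularCurveGenusTwoProofs`
the fact is now proved for `N ∈ {1, …, 16, 18, 20, 22, 23, 24, 25, 27, 28, 30, 32, 33, 35, 36, 46,
54, 64}` (`finrank_cuspForm_two_eq_genusX0_of_mem_levels₂`), in particular for every `N ≤ 16`.

## Proofs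

*Invariance.* For `γ = (a b; c d) ∈ Γ₀(N)` with `c > 0`, `d` odd, and `δ ∣ N`, we have
`δ·γτ = γ_δ(δτ)` with `γ_δ = (a, bδ; c/δ, d) ∈ SL₂(ℤ)`, so the transformation law of `η`
(`eta_SL2_smul`, `ModularCurveEtaMultiplierProofs`, in the second Petersson–Knopp form
`v_η(γ_δ) = (c δ⁻¹/|d|) e^{πi[(a+d)cδ⁻¹ - bδd(c²δ⁻² - 1) + 3d - 3 - 3cδ⁻¹d]/12}`,
valid as `d` is odd)
gives `f(γτ) = [∏_δ v_η(γ_δ)^{r_δ}] (cτ+d)^k f(τ)`; the Jacobi symbols multiply to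
`(∏ δ^{|r_δ|}/|d|) = (t²/|d|) = 1` (`newman_jacobi_prod_eq_one`) and the exponents add up to
`[(a-2d)c' - bdc'²N] Σ(N/δ)r_δ + bd Σδr_δ + 6k(d-1) ≡ 0 (mod 24)` (`newman_exponent_sum_dvd`). The
cases `d` even, `c < 0`, `c = 0` reduce to this one by `γ = (γT⁻¹)T`, `γ ↦ -γ` and periodicity.

*Cusps.* Writing `diag(δ,1)γ = γ'(g m; 0 δ/g)` with `γ' ∈ SL₂(ℤ)`, `g = gcd(δ, c)`
(`exists_SL2_decomposition`) and using `|η(γ'z)|² = |c'z+d'| |η(z)|²` (from the character of `η²`)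
we get `|η(δγτ)|² = |cτ+d| (g/δ) e^{-πg² Im τ/(6δ)} |∏(1-qⁿ)|²` and hence
`|(f|_kγ)(τ)|² = C e^{-π Im τ · cuspOrder24/(6N)} · (1 + o(1))`.

## References

* D. Savitt, *An elementary proof of Newman's eta-quotient theorem*, Res. Number Theory (2025),
  arXiv:2507.16225 — Thm. 1 (Newman's theorem), Rem. 2 (orders at the cusps). [Savitt2025]
* M. Newman, *Construction and application of a class of modular functions II*, Proc. London
  Math. Soc. (3) 9 (1959), 373–387. [Newman1959]
* G. Ligozat, *Courbes modulaires de genre 1*, Mém. SMF 43 (1975). [Ligozat1975]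
* M. I. Knopp, *Modular functions in analytic number theory* (1970), Ch. 4, Thm. 2. [Knopp1970]
* F. Diamond, J. Shurman, *A First Course in Modular Forms*, Thm. 3.5.1. [DiamondShurman2005]
-/

noncomputable section

open UpperHalfPlane hiding I
open ModularForm Complex Matrix.SpecialLinearGroup Filter Asymptotics CongruenceSubgroup
open scoped MatrixGroups Real ModularForm CongruenceSubgroup Topology Manifold NumberTheorySymbols

namespace Literature.NumberTheory.EllipticCurves.ModularForms

/-! ### `η`-quotients: definition, holomorphy, periodicity, behaviour at `i∞` -/

/-- The **`η`-quotient** `∏_{δ ∣ N} η(δz)^{r_δ}` attached to a level `N` and an exponent vector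
`r` (only the values `r_δ`, `δ ∣ N`, matter), as a function on `ℂ`. [folklore] -/
def etaQuotientC (N : ℕ) (r : ℕ → ℤ) (z : ℂ) : ℂ := ∏ δ ∈ N.divisors, η (δ * z) ^ (r δ)

/-- The `η`-quotient `∏_{δ ∣ N} η(δτ)^{r_δ}` on `ℍ`. [folklore] -/
def etaQuotient (N : ℕ) (r : ℕ → ℤ) (τ : ℍ) : ℂ := etaQuotientC N r τ

/-- Unfolding `etaQuotient`. [folklore] -/
theorem etaQuotient_apply (N : ℕ) (r : ℕ → ℤ) (τ : ℍ) :
    etaQuotient N r τ = ∏ δ ∈ N.divisors, η (δ * (τ : ℂ)) ^ (r δ) := rfl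

/-- `δτ ∈ ℍ` for `δ ≥ 1`. [folklore] -/
theorem im_natMul_pos {δ : ℕ} (hδ : 0 < δ) {z : ℂ} (hz : 0 < z.im) : 0 < ((δ : ℂ) * z).im := by
  simpa using mul_pos (Nat.cast_pos.mpr hδ) hz

/-- `η(δz) ≠ 0` for `Im z > 0`, `δ ≥ 1`. [folklore] -/
theorem eta_natMul_ne_zero {δ : ℕ} (hδ : 0 < δ) {z : ℂ} (hz : 0 < z.im) : η (δ * z) ≠ 0 :=
  eta_ne_zero (im_natMul_pos hδ hz)

/-- The `η`-quotient does not vanish on `ℍ`. [folklore] -/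
theorem etaQuotient_ne_zero (N : ℕ) (r : ℕ → ℤ) (τ : ℍ) : etaQuotient N r τ ≠ 0 := by
  rw [etaQuotient_apply]
  exact Finset.prod_ne_zero_iff.mpr fun δ hδ ↦
    zpow_ne_zero (r δ) (eta_natMul_ne_zero (Nat.pos_of_mem_divisors hδ) τ.2)

/-- `η`-quotients are holomorphic on the upper half-plane (as functions on `ℂ`). [folklore] -/
theorem differentiableOn_etaQuotientC (N : ℕ) (r : ℕ → ℤ) :
    DifferentiableOn ℂ (etaQuotientC N r) {z : ℂ | 0 < z.im} := by
  unfold etaQuotientC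
  refine DifferentiableOn.fun_finsetProd (u := N.divisors) (𝔸' := ℂ)
    (f := fun δ z ↦ η (δ * z) ^ (r δ)) fun δ hδ ↦ ?_
  have hδ0 := Nat.pos_of_mem_divisors hδ
  refine DifferentiableOn.zpow (fun z hz ↦ ?_) (Or.inl fun z hz ↦ eta_natMul_ne_zero hδ0 hz)
  exact ((differentiableAt_eta_of_mem_upperHalfPlaneSet (im_natMul_pos hδ0 hz)).comp z
    ((differentiableAt_const _).mul differentiableAt_id)).differentiableWithinAt

/-- **`η`-quotients are holomorphic on `ℍ`.** [folklore] -/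
theorem mdifferentiable_etaQuotient (N : ℕ) (r : ℕ → ℤ) : MDiff (etaQuotient N r) := by
  rw [UpperHalfPlane.mdifferentiable_iff]
  exact (differentiableOn_etaQuotientC N r).congr fun z hz ↦ by
    simp [etaQuotient, ofComplex_apply_of_im_pos hz]

/-- `η(z + n) = e^{2πi n/24} η(z)` for `n ∈ ℤ`. [folklore] -/
theorem eta_add_intCast (z : ℂ) (n : ℤ) : η (z + n) = cexp (2 * π * I * n / 24) * η z := by
  simp only [ModularForm.eta]
  have hq : ∀ m : ℕ, eta_q m (z + n) = eta_q m z := fun m ↦ by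
    rw [eta_q_eq_cexp, eta_q_eq_cexp, mul_add, Complex.exp_add]
    have : cexp (2 * π * I * (m + 1) * n) = 1 := by
      rw [show (2 * π * I * (m + 1) * n : ℂ) = ((m + 1) * n : ℤ) * (2 * π * I) by push_cast; ring,
        Complex.exp_int_mul_two_pi_mul_I]
    rw [this, mul_one]
  simp only [hq]
  rw [← mul_assoc]
  congr 1
  simp only [Function.Periodic.qParam]
  rw [← Complex.exp_add]
  congr 1
  push_cast
  ring

/-- `η(δ(z + 1)) = e^{2πi δ/24} η(δz)`. [folklore] -/
theorem eta_natMul_add_one (δ : ℕ) (z : ℂ) :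
    η (δ * (z + 1)) = cexp (2 * π * I * δ / 24) * η (δ * z) := by
  rw [mul_add, mul_one, show ((δ : ℂ)) = ((δ : ℤ) : ℂ) by simp, eta_add_intCast]

/-- **Periodicity**: `∏ η(δ(z+1))^{r_δ} = e^{2πi Σ δ r_δ/24} ∏ η(δz)^{r_δ}`. [folklore] -/
theorem etaQuotientC_add_one (N : ℕ) (r : ℕ → ℤ) (z : ℂ) :
    etaQuotientC N r (z + 1) =
      cexp (2 * π * I * (∑ δ ∈ N.divisors, (δ : ℤ) * r δ : ℤ) / 24) * etaQuotientC N r z := by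
  unfold etaQuotientC
  simp_rw [eta_natMul_add_one, mul_zpow, Finset.prod_mul_distrib]
  congr 1
  rw [show (2 * π * I * ((∑ δ ∈ N.divisors, (δ : ℤ) * r δ : ℤ) : ℂ) / 24 : ℂ) =
      ∑ δ ∈ N.divisors, (r δ : ℂ) * (2 * π * I * δ / 24) by
    push_cast
    rw [Finset.mul_sum, Finset.sum_div]
    exact Finset.sum_congr rfl fun δ _ ↦ by ring, Complex.exp_sum]
  refine Finset.prod_congr rfl fun δ _ ↦ ?_
  rw [← Complex.exp_int_mul]

/-- Periodicity under `z ↦ z + 1` when `24 ∣ Σ δ r_δ`. [folklore] -/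
theorem etaQuotientC_add_one_of_dvd (N : ℕ) (r : ℕ → ℤ)
    (h : (24 : ℤ) ∣ ∑ δ ∈ N.divisors, (δ : ℤ) * r δ) (z : ℂ) :
    etaQuotientC N r (z + 1) = etaQuotientC N r z := by
  obtain ⟨t, ht⟩ := h
  rw [etaQuotientC_add_one, ht, show (2 * π * I * ((24 * t : ℤ) : ℂ) / 24 : ℂ) = t * (2 * π * I) by
    push_cast; ring, Complex.exp_int_mul_two_pi_mul_I, one_mul]

/-- Periodicity under `z ↦ z + n`, `n ∈ ℤ`, when `24 ∣ Σ δ r_δ`. [folklore] -/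
theorem etaQuotientC_add_intCast_of_dvd (N : ℕ) (r : ℕ → ℤ)
    (h : (24 : ℤ) ∣ ∑ δ ∈ N.divisors, (δ : ℤ) * r δ) (z : ℂ) (n : ℤ) :
    etaQuotientC N r (z + n) = etaQuotientC N r z := by
  induction n using Int.induction_on generalizing z with
  | zero => simp
  | succ k ih => rw [Int.cast_add, Int.cast_one, ← add_assoc, etaQuotientC_add_one_of_dvd N r h, ih]
  | pred k ih =>
    have := etaQuotientC_add_one_of_dvd N r h (z + ((-(k : ℤ) - 1 : ℤ) : ℂ))
    rw [← this, ← ih z]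
    congr 1; push_cast; ring

/-- **Leading asymptotics at `i∞`**: `∏ η(δτ)^{r_δ} / e^{2πi n τ} → 1` as `Im τ → ∞`, where
`24 n = Σ δ r_δ` is `24` times the order of vanishing at the cusp `∞`. [folklore] -/
theorem tendsto_etaQuotient_div_qParam_zpow (N : ℕ) (r : ℕ → ℤ) (n : ℤ)
    (hn : ∑ δ ∈ N.divisors, (δ : ℤ) * r δ = 24 * n) :
    Tendsto (fun τ : ℍ ↦ etaQuotient N r τ / Function.Periodic.qParam 1 τ ^ n) atImInfty (𝓝 1) := by
  -- each factor: `η(δτ) = 𝕢₂₄(δτ) P_δ(τ)` with `P_δ → 1`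
  have hP : ∀ δ ∈ N.divisors, Tendsto (fun τ : ℍ ↦ (∏' m : ℕ, (1 - eta_q m ((δ : ℂ) * τ))) ^ (r δ))
      atImInfty (𝓝 1) := fun δ hδ ↦ by
    have := (tendsto_eta_tprod_mul_atImInfty (a := (δ : ℝ))
      (by exact_mod_cast Nat.pos_of_mem_divisors hδ)).zpow₀ (m := r δ) (Or.inl one_ne_zero)
    rw [one_zpow] at this
    exact this.congr fun τ ↦ by push_cast; rfl
  have hprod := tendsto_finsetProd N.divisors hP
  rw [Finset.prod_const_one] at hprod
  refine hprod.congr fun τ ↦ ?_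
  have hq : ∀ δ : ℕ, Function.Periodic.qParam 24 ((δ : ℂ) * τ) ^ (r δ) =
      cexp (2 * π * I * τ * ((δ : ℤ) * r δ : ℤ) / 24) := fun δ ↦ by
    rw [Function.Periodic.qParam, ← Complex.exp_int_mul]
    congr 1; push_cast; ring
  have hqn : Function.Periodic.qParam 1 (τ : ℂ) ^ n = cexp (2 * π * I * τ * (24 * n : ℤ) / 24) := by
    rw [Function.Periodic.qParam, ← Complex.exp_int_mul]
    congr 1; push_cast; ring
  rw [etaQuotient_apply,
    eq_div_iff (zpow_ne_zero _ (by simp [Function.Periodic.qParam, Complex.exp_ne_zero])),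
    hqn, ← hn, Int.cast_sum]
  simp_rw [eta_eq_qParam_mul_tprod, mul_zpow, Finset.prod_mul_distrib, hq]
  rw [mul_comm, ← Complex.exp_sum]
  congr 2
  rw [Finset.mul_sum, Finset.sum_div]

/-! ### Behaviour of `η(δ γτ)` for arbitrary `γ ∈ SL₂(ℤ)`: the Hermite decomposition -/

/-- The point `(gτ + m)/a' ∈ ℍ` (`g, a' > 0`). [folklore] -/
def affPt (g : ℕ) (m : ℤ) (a' : ℕ) (hg : 0 < g) (ha' : 0 < a') (τ : ℍ) : ℍ :=
  ⟨((g : ℂ) * τ + m) / a', by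
    rw [Complex.div_natCast_im]
    apply div_pos _ (Nat.cast_pos.mpr ha')
    simpa using mul_pos (Nat.cast_pos.mpr hg) τ.2⟩

/-- The coordinates of `affPt`. [folklore] -/
theorem coe_affPt (g : ℕ) (m : ℤ) (a' : ℕ) (hg : 0 < g) (ha' : 0 < a') (τ : ℍ) :
    ((affPt g m a' hg ha' τ : ℍ) : ℂ) = ((g : ℂ) * τ + m) / a' := rfl

/-- `Im ((gτ + m)/a') = (g/a') Im τ`. [folklore] -/
theorem im_affPt (g : ℕ) (m : ℤ) (a' : ℕ) (hg : 0 < g) (ha' : 0 < a') (τ : ℍ) :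
    (affPt g m a' hg ha' τ).im = (g : ℝ) / a' * τ.im := by
  change (((g : ℂ) * τ + m) / a').im = _
  rw [Complex.div_natCast_im]
  simp
  ring

/-- `Im (affPt τ) → ∞` as `Im τ → ∞`. [folklore] -/
theorem tendsto_affPt_atImInfty (g : ℕ) (m : ℤ) (a' : ℕ) (hg : 0 < g) (ha' : 0 < a') :
    Tendsto (affPt g m a' hg ha') atImInfty atImInfty := by
  rw [atImInfty, tendsto_comap_iff]
  have : UpperHalfPlane.im ∘ affPt g m a' hg ha' = fun τ ↦ (g : ℝ) / a' * τ.im := by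
    funext τ; exact im_affPt g m a' hg ha' τ
  rw [this]
  exact tendsto_comap.const_mul_atTop (div_pos (Nat.cast_pos.mpr hg) (Nat.cast_pos.mpr ha'))

/-- The coordinate of `γ • τ` for `γ ∈ SL₂(ℤ)`. [folklore] -/
theorem coe_SL2_smul (γ : SL(2, ℤ)) (τ : ℍ) :
    ((γ • τ : ℍ) : ℂ) = ((γ 0 0 : ℂ) * τ + γ 0 1) / ((γ 1 0 : ℂ) * τ + γ 1 1) := by
  rw [UpperHalfPlane.specialLinearGroup_apply]
  simp

/-- The denominator `cτ + d ≠ 0`. [folklore] -/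
theorem SL2_denom_ne_zero (γ : SL(2, ℤ)) (τ : ℍ) : (γ 1 0 : ℂ) * τ + γ 1 1 ≠ 0 := by
  have := UpperHalfPlane.denom_ne_zero (γ : GL (Fin 2) ℝ) τ
  rwa [ModularGroup.denom_apply] at this

/-- **Hermite decomposition of `diag(a, 1) γ`**: for `a ≥ 1` and `γ = (* *; c d) ∈ SL₂(ℤ)`
there are `γ' ∈ SL₂(ℤ)`, `g = gcd(a, c)`, `a' = a/g` and `m ∈ ℤ` with
`a · γτ = γ'((gτ + m)/a')` and `j(γ', (gτ + m)/a') = (cτ + d)/a'` (so that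
`diag(a,1) γ = γ' (g m; 0 a')`). [folklore] -/
theorem exists_SL2_decomposition (a : ℕ) (ha : 0 < a) (γ : SL(2, ℤ)) :
    ∃ (γ' : SL(2, ℤ)) (g a' : ℕ) (m : ℤ) (hg : 0 < g) (ha' : 0 < a'),
      g * a' = a ∧ g = Int.gcd (a : ℤ) (γ 1 0) ∧
      (∀ τ : ℍ, (a : ℂ) * ((γ • τ : ℍ) : ℂ) = ((γ' • affPt g m a' hg ha' τ : ℍ) : ℂ)) ∧
      (∀ τ : ℍ, (γ' 1 0 : ℂ) * (affPt g m a' hg ha' τ : ℂ) + γ' 1 1 =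
        ((γ 1 0 : ℂ) * τ + γ 1 1) / a') := by
  have haZ : 0 < (a : ℤ) := by exact_mod_cast ha
  have hdet : γ 0 0 * γ 1 1 - γ 0 1 * γ 1 0 = 1 := by
    have := Matrix.det_fin_two (γ : Matrix (Fin 2) (Fin 2) ℤ)
    rw [γ.det_coe] at this
    linarith
  set p : ℤ := a * γ 0 0 with hp
  set r : ℤ := γ 1 0 with hr
  set q : ℤ := a * γ 0 1 with hq
  set s : ℤ := γ 1 1 with hs
  have hps : p * s - r * q = a := by
    simp only [hp, hr, hq, hs]; linear_combination (a : ℤ) * hdet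
  set g : ℤ := (Int.gcd p r : ℤ) with hgdef
  have hg0 : g ≠ 0 := by
    intro h0
    have h0' : Int.gcd p r = 0 := by rw [hgdef] at h0; exact_mod_cast h0
    rw [Int.gcd_eq_zero_iff] at h0'
    have : (a : ℤ) = 0 := by rw [← hps, h0'.1, h0'.2]; ring
    exact haZ.ne' this
  have hgpos : 0 < g := lt_of_le_of_ne (by simp [hgdef]) (Ne.symm hg0)
  obtain ⟨p', hp'⟩ : g ∣ p := Int.gcd_dvd_left ..
  obtain ⟨r', hr'⟩ : g ∣ r := Int.gcd_dvd_right ..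
  set x : ℤ := Int.gcdA p r
  set y : ℤ := Int.gcdB p r
  have hbez : p * x + r * y = g := (Int.gcd_eq_gcd_ab p r).symm
  have hbez' : p' * x + r' * y = 1 := by
    have : g * (p' * x + r' * y - 1) = 0 := by
      linear_combination (hp' ▸ hr' ▸ hbez : (g * p') * x + (g * r') * y = g)
    rcases mul_eq_zero.mp this with h | h
    · exact absurd h hg0
    · linarith
  set a' : ℤ := p' * s - r' * q with ha'
  have hga' : g * a' = a := by rw [ha', ← hps, hp', hr']; ring
  have ha'pos : 0 < a' := by
    rcases lt_trichotomy a' 0 with h | h | h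
    · nlinarith
    · rw [h, mul_zero] at hga'; linarith
    · exact h
  let γ' : SL(2, ℤ) := ⟨!![p', -y; r', x], by rw [Matrix.det_fin_two_of]; linear_combination hbez'⟩
  set m : ℤ := x * q + y * s with hm
  have hq' : q = p' * m + (-y) * a' := by rw [hm, ha']; linear_combination (-q) * hbez'
  have hs' : s = r' * m + x * a' := by rw [hm, ha']; linear_combination (-s) * hbez'
  -- the natural-number versions
  obtain ⟨gn, hgn⟩ := Int.eq_ofNat_of_zero_le hgpos.le
  obtain ⟨an, han⟩ := Int.eq_ofNat_of_zero_le ha'pos.le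
  have hgn0 : 0 < gn := by rw [hgn] at hgpos; exact_mod_cast hgpos
  have han0 : 0 < an := by rw [han] at ha'pos; exact_mod_cast ha'pos
  refine ⟨γ', gn, an, m, hgn0, han0, ?_, ?_, ?_, ?_⟩
  · have : (gn : ℤ) * an = a := by rw [← hgn, ← han, hga']
    exact_mod_cast this
  · -- `g = gcd(a γ₀₀, γ₁₀) = gcd(a, γ₁₀)` since `gcd(γ₀₀, γ₁₀) = 1`
    have hcop : Nat.Coprime (γ 0 0).natAbs (γ 1 0).natAbs := by
      have : Int.gcd (γ 0 0) (γ 1 0) = 1 := by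
        rw [← Int.isCoprime_iff_gcd_eq_one]
        exact ⟨γ 1 1, -γ 0 1, by linear_combination hdet⟩
      exact this
    have h1 : Int.gcd p r = Int.gcd (a : ℤ) (γ 1 0) := by
      change (p.natAbs).gcd r.natAbs = ((a : ℤ).natAbs).gcd (γ 1 0).natAbs
      rw [hp, hr, Int.natAbs_mul, Int.natAbs_natCast, Nat.Coprime.gcd_mul_right_cancel a hcop]
    have : (gn : ℤ) = (Int.gcd (a : ℤ) (γ 1 0) : ℤ) := by rw [← hgn, hgdef, h1]
    exact_mod_cast this
  · intro τ
    have hden := SL2_denom_ne_zero γ τ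
    have hanC : (an : ℂ) ≠ 0 := by exact_mod_cast han0.ne'
    -- integer identities, cast to `ℂ`
    have ep : (p : ℂ) = p' * gn := by
      have : (p : ℤ) = p' * gn := by rw [hp', hgn]; ring
      exact_mod_cast this
    have er : (r : ℂ) = r' * gn := by
      have : (r : ℤ) = r' * gn := by rw [hr', hgn]; ring
      exact_mod_cast this
    have eq' : (q : ℂ) = p' * m + (-y) * an := by
      have := congrArg (Int.cast : ℤ → ℂ) hq'; push_cast [han] at this; exact this
    have es' : (s : ℂ) = r' * m + x * an := by
      have := congrArg (Int.cast : ℤ → ℂ) hs'; push_cast [han] at this; exact this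
    have hN : (γ' 0 0 : ℂ) * (affPt gn m an hgn0 han0 τ : ℂ) + γ' 0 1 = ((p : ℂ) * τ + q) / an := by
      rw [coe_affPt]
      simp only [γ', Matrix.of_apply, Matrix.cons_val', Matrix.cons_val_zero, Matrix.cons_val_one,
        Matrix.empty_val', Matrix.cons_val_fin_one]
      rw [ep, eq']; field_simp; push_cast; ring
    have hD : (γ' 1 0 : ℂ) * (affPt gn m an hgn0 han0 τ : ℂ) + γ' 1 1 = ((r : ℂ) * τ + s) / an := by
      rw [coe_affPt]
      simp only [γ', Matrix.of_apply, Matrix.cons_val', Matrix.cons_val_zero, Matrix.cons_val_one,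
        Matrix.empty_val', Matrix.cons_val_fin_one]
      rw [er, es']; field_simp; ring
    have hrs : (r : ℂ) * τ + s ≠ 0 := by rw [hr, hs]; exact hden
    rw [coe_SL2_smul, coe_SL2_smul, hN, hD, div_div_div_cancel_right₀ hanC, ← mul_div_assoc,
      div_eq_div_iff hden hrs, hp, hq, hr, hs]
    push_cast
    ring
  · intro τ
    rw [coe_affPt]
    simp only [γ', Matrix.of_apply, Matrix.cons_val', Matrix.cons_val_zero, Matrix.cons_val_one,
      Matrix.empty_val', Matrix.cons_val_fin_one]
    have hanC : (an : ℂ) ≠ 0 := by exact_mod_cast han0.ne'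
    have e2 : ((γ 1 0 : ℤ) : ℂ) = r' * gn := by
      have : (r : ℤ) = r' * gn := by rw [hr', hgn]; ring
      exact_mod_cast this
    have e4 : ((γ 1 1 : ℤ) : ℂ) = r' * m + x * an := by
      have := congrArg (Int.cast : ℤ → ℂ) hs'
      push_cast [hs, han] at this
      exact this
    rw [e2, e4]
    field_simp
    ring

/-! ### Size of `η(δ γτ)` and vanishing of `η`-quotients at all cusps -/

/-- **`|η(γz)|² = |cz + d| |η(z)|²`** for every `γ ∈ SL₂(ℤ)` (from the character of `η²`, whose
values have modulus `1`). [folklore] -/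
theorem norm_eta_SL2_smul_sq (γ : SL(2, ℤ)) (z : ℍ) :
    ‖η (↑(γ • z))‖ ^ 2 = ‖(γ 1 0 : ℂ) * z + γ 1 1‖ * ‖η z‖ ^ 2 := by
  have h := congrFun (etaSq_slash_SL2 γ) z
  rw [SL_slash_apply, ModularGroup.denom_apply, zpow_neg_one] at h
  simp only [Pi.smul_apply, smul_eq_mul, etaSq] at h
  have hden := SL2_denom_ne_zero γ z
  have hn := congrArg (‖·‖) h
  simp only [norm_mul, norm_inv, norm_pow, Complex.norm_exp] at hn
  rw [show (π * I / 6 * (etaSqExp (γ 0 0) (γ 0 1) (γ 1 0) (γ 1 1) : ℂ)).re = 0 by simp,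
    Real.exp_zero, one_mul] at hn
  rw [← hn, mul_comm, mul_assoc, inv_mul_cancel₀ (norm_ne_zero_iff.mpr hden), mul_one]

/-- `|η(z)|² = e^{-π Im z/6} |∏_{n≥1}(1 - qⁿ)|²`. [folklore] -/
theorem norm_eta_sq_eq (z : ℂ) :
    ‖η z‖ ^ 2 = Real.exp (-(π * z.im / 6)) * ‖∏' n : ℕ, (1 - eta_q n z)‖ ^ 2 := by
  rw [eta_eq_qParam_mul_tprod, norm_mul, mul_pow, Function.Periodic.norm_qParam, ← Real.exp_nat_mul]
  congr 2
  push_cast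
  ring

/-- `∏_{n ≥ 1}(1 - qⁿ((gτ+m)/a')) → 1` as `Im τ → ∞`. [folklore] -/
theorem tendsto_tprod_affPt (g : ℕ) (m : ℤ) (a' : ℕ) (hg : 0 < g) (ha' : 0 < a') :
    Tendsto (fun τ : ℍ ↦ ∏' n : ℕ, (1 - eta_q n (affPt g m a' hg ha' τ : ℂ))) atImInfty (𝓝 1) := by
  have := tendsto_tprod_one_sub_pow_nhds_zero.comp
    ((UpperHalfPlane.qParam_tendsto_atImInfty zero_lt_one).comp
      (tendsto_affPt_atImInfty g m a' hg ha'))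
  exact this.congr fun τ ↦ by simp [eta_q]

/-- **Size of `η(δ·γτ)`**: for `δ ≥ 1` and `γ = (* *; c d) ∈ SL₂(ℤ)` there are a constant
`C > 0` and a function `Q → 1` (`Im τ → ∞`) with
`|η(δ γτ)|² = |cτ + d| · C · exp(-π gcd(δ,c)² Im τ / (6δ)) · Q(τ)`. (For `δ = 0` the statement
is vacuous.) [folklore] -/
theorem exists_norm_eta_natMul_SL2_smul_sq (δ : ℕ) (γ : SL(2, ℤ)) :
    ∃ (C : ℝ) (Q : ℍ → ℝ), 0 < C ∧ Tendsto Q atImInfty (𝓝 1) ∧ (0 < δ → ∀ τ : ℍ,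
      ‖η (δ * ((γ • τ : ℍ) : ℂ))‖ ^ 2 = ‖(γ 1 0 : ℂ) * τ + γ 1 1‖ *
        (C * Real.exp (-(π * ((Int.gcd δ (γ 1 0) : ℝ) ^ 2 / δ) * τ.im / 6)) * Q τ)) := by
  rcases Nat.eq_zero_or_pos δ with rfl | hδ
  · exact ⟨1, 1, one_pos, tendsto_const_nhds, fun h ↦ absurd h (lt_irrefl 0)⟩
  obtain ⟨γ', g, a', m, hg, ha', hga, hgcd, hsmul, hden⟩ := exists_SL2_decomposition δ hδ γ
  refine ⟨(a' : ℝ)⁻¹, fun τ ↦ ‖∏' n : ℕ, (1 - eta_q n (affPt g m a' hg ha' τ : ℂ))‖ ^ 2,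
    inv_pos.mpr (Nat.cast_pos.mpr ha'), ?_, fun _ τ ↦ ?_⟩
  · simpa using (tendsto_tprod_affPt g m a' hg ha').norm.pow 2
  · rw [hsmul τ, norm_eta_SL2_smul_sq, hden τ, norm_div, Complex.norm_natCast, norm_eta_sq_eq,
      UpperHalfPlane.coe_im, im_affPt, ← hgcd]
    have hslope : (g : ℝ) / a' = (g : ℝ) ^ 2 / δ := by
      rw [← hga]; push_cast; field_simp
    rw [hslope]
    ring_nf

/-- `24 N` times the **order at the cusp** of an `η`-quotient determined by the lower-left entry
`c` of `γ`: `Σ_δ r_δ gcd(δ, c)² (N/δ)` (Ligozat's formula; the order at the cusp `a/c` of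
`Γ₀(N)` in the local parameter is this divided by `24 gcd(c², N)`-type width factors, which do
not affect the sign). [folklore] -/
def cuspOrder24 (N : ℕ) (r : ℕ → ℤ) (c : ℤ) : ℤ :=
  ∑ δ ∈ N.divisors, r δ * (Int.gcd δ c : ℤ) ^ 2 * ((N / δ : ℕ) : ℤ)

/-- `∏_δ x^{r_δ} = x^{Σ r_δ}` for `x ≠ 0`. [folklore] -/
theorem real_prod_zpow_eq_zpow_sum {x : ℝ} (hx : x ≠ 0) (s : Finset ℕ) (r : ℕ → ℤ) :
    ∏ δ ∈ s, x ^ (r δ) = x ^ (∑ δ ∈ s, r δ) := by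
  induction s using Finset.induction_on with
  | empty => simp
  | insert a s ha ih => rw [Finset.prod_insert ha, Finset.sum_insert ha, ih, zpow_add₀ hx]

/-- `exp(u)^r = exp(r u)` for `r ∈ ℤ`. [folklore] -/
theorem real_exp_zpow (u : ℝ) (r : ℤ) : Real.exp u ^ r = Real.exp (r * u) := by
  rw [mul_comm, Real.exp_mul, Real.rpow_intCast]

/-- **`η`-quotients vanish at every cusp where Ligozat's order is positive**: if
`Σ_δ r_δ = 2k` and `Σ_δ r_δ gcd(δ, c)² (N/δ) > 0` for the lower-left entry `c` of `γ ∈ SL₂(ℤ)`,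
then `(∏ η(δτ)^{r_δ})|_k γ → 0` as `Im τ → ∞`. The proof writes `δ·γ = γ'_δ (g m; 0 δ/g)`
(`g = gcd(δ, c)`), so that `|η(δγτ)|² = |cτ+d| (g/δ) e^{-π g² Im τ/(6δ)} |∏(1 - qⁿ)|²`, and
multiplies up (Savitt 2025, Rem. 2, attributed to Ligozat 1975). [cite: Savitt2025, Rem. 2] -/
theorem isZeroAtImInfty_etaQuotient_slash (N : ℕ) (hN : 0 < N) (r : ℕ → ℤ) (k : ℤ)
    (hk : ∑ δ ∈ N.divisors, r δ = 2 * k) (γ : SL(2, ℤ)) (hord : 0 < cuspOrder24 N r (γ 1 0)) :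
    IsZeroAtImInfty (etaQuotient N r ∣[k] (γ : GL (Fin 2) ℝ)) := by
  choose C Q hC hQ hnorm using fun δ ↦ exists_norm_eta_natMul_SL2_smul_sq δ γ
  -- the exponential rate
  set s : ℝ := ∑ δ ∈ N.divisors, (r δ : ℝ) * (-(π * ((Int.gcd δ (γ 1 0) : ℝ) ^ 2 / δ) / 6)) with hs
  have hs_neg : s < 0 := by
    have hsum : s = -(π / (6 * N)) * (cuspOrder24 N r (γ 1 0) : ℝ) := by
      rw [hs, cuspOrder24, Int.cast_sum, Finset.mul_sum]
      refine Finset.sum_congr rfl fun δ hδ ↦ ?_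
      have hδ0 : (δ : ℝ) ≠ 0 := by exact_mod_cast (Nat.pos_of_mem_divisors hδ).ne'
      have hNδ : ((N / δ : ℕ) : ℝ) = (N : ℝ) / δ := by
        rw [Nat.cast_div (Nat.dvd_of_mem_divisors hδ) hδ0]
      rw [Int.cast_mul, Int.cast_mul, Int.cast_pow, Int.cast_natCast, Int.cast_natCast, hNδ]
      field_simp
    rw [hsum]
    exact mul_neg_of_neg_of_pos (neg_neg_of_pos (by positivity)) (by exact_mod_cast hord)
  -- the formula for `‖(f|γ)(τ)‖²`
  have hformula : ∀ τ : ℍ, ‖(etaQuotient N r ∣[k] (γ : GL (Fin 2) ℝ)) τ‖ ^ 2 =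
      (∏ δ ∈ N.divisors, C δ ^ (r δ)) * Real.exp (s * τ.im) * ∏ δ ∈ N.divisors, Q δ τ ^ (r δ) := by
    intro τ
    have hj := SL2_denom_ne_zero γ τ
    have hjn : ‖(γ 1 0 : ℂ) * τ + γ 1 1‖ ≠ 0 := norm_ne_zero_iff.mpr hj
    rw [← SL_slash, SL_slash_apply (f := etaQuotient N r), ModularGroup.denom_apply,
      etaQuotient_apply, norm_mul, mul_pow, norm_zpow, Complex.norm_prod, ← Finset.prod_pow]
    have hfac : ∀ δ ∈ N.divisors, ‖η (δ * ((γ • τ : ℍ) : ℂ)) ^ (r δ)‖ ^ 2 =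
        ‖(γ 1 0 : ℂ) * τ + γ 1 1‖ ^ (r δ) * ((C δ * Real.exp (-(π * ((Int.gcd δ (γ 1 0) : ℝ) ^ 2
          / δ) * τ.im / 6))) ^ (r δ) * Q δ τ ^ (r δ)) := fun δ hδ ↦ by
      rw [norm_zpow, ← zpow_natCast (‖η (δ * ((γ • τ : ℍ) : ℂ))‖ ^ r δ), ← zpow_mul,
        mul_comm (r δ), zpow_mul, zpow_natCast, hnorm δ (Nat.pos_of_mem_divisors hδ) τ, mul_zpow,
        mul_zpow]
    rw [Finset.prod_congr rfl hfac, Finset.prod_mul_distrib, Finset.prod_mul_distrib,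
      real_prod_zpow_eq_zpow_sum hjn, hk]
    -- the automorphy factors cancel
    have hcancel :
        ‖(γ 1 0 : ℂ) * τ + γ 1 1‖ ^ (2 * k) * (‖(γ 1 0 : ℂ) * τ + γ 1 1‖ ^ (-k)) ^ 2 = 1 := by
      rw [← zpow_natCast (‖(γ 1 0 : ℂ) * τ + γ 1 1‖ ^ (-k)), ← zpow_mul, ← zpow_add₀ hjn,
        show 2 * k + -k * ((2 : ℕ) : ℤ) = 0 by push_cast; ring, zpow_zero]
    -- the exponential factors combine
    have hexp : ∏ δ ∈ N.divisors, (C δ * Real.exp (-(π * ((Int.gcd δ (γ 1 0) : ℝ) ^ 2 / δ) *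
        τ.im / 6))) ^ (r δ) = (∏ δ ∈ N.divisors, C δ ^ (r δ)) * Real.exp (s * τ.im) := by
      simp_rw [mul_zpow, Finset.prod_mul_distrib, real_exp_zpow, ← Real.exp_sum]
      congr 2
      rw [hs, Finset.sum_mul]
      exact Finset.sum_congr rfl fun δ _ ↦ by ring
    rw [hexp]
    linear_combination (∏ δ ∈ N.divisors, C δ ^ r δ) * Real.exp (s * τ.im) *
      (∏ δ ∈ N.divisors, Q δ τ ^ r δ) * hcancel
  -- the limit
  have hlim : Tendsto (fun τ : ℍ ↦ ‖(etaQuotient N r ∣[k] (γ : GL (Fin 2) ℝ)) τ‖ ^ 2) atImInfty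
      (𝓝 0) := by
    simp_rw [hformula]
    have hQ' : Tendsto (fun τ : ℍ ↦ ∏ δ ∈ N.divisors, Q δ τ ^ (r δ)) atImInfty (𝓝 1) := by
      have := tendsto_finsetProd N.divisors
        (fun δ _ ↦ ((hQ δ).zpow₀ (m := r δ) (Or.inl one_ne_zero)))
      simpa using this
    have hE : Tendsto (fun τ : ℍ ↦ Real.exp (s * τ.im)) atImInfty (𝓝 0) :=
      Real.tendsto_exp_atBot.comp
        ((tendsto_comap (f := UpperHalfPlane.im)).const_mul_atTop_of_neg hs_neg)
    simpa using ((hE.const_mul (∏ δ ∈ N.divisors, C δ ^ (r δ))).mul hQ')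
  -- `‖·‖² → 0` gives `‖·‖ → 0`
  rw [IsZeroAtImInfty, ZeroAtFilter, tendsto_zero_iff_norm_tendsto_zero]
  have := hlim.sqrt
  rw [Real.sqrt_zero] at this
  exact this.congr fun τ ↦ by rw [Real.sqrt_sq (norm_nonneg _)]

/-! ### Newman's criterion: `Γ₀(N)`-invariance of `η`-quotients -/

/-- The point `δτ ∈ ℍ`. [folklore] -/
def natMulPt (δ : ℕ) (hδ : 0 < δ) (τ : ℍ) : ℍ := ⟨(δ : ℂ) * τ, im_natMul_pos hδ τ.2⟩

/-- Coordinates of `natMulPt`. [folklore] -/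
theorem coe_natMulPt (δ : ℕ) (hδ : 0 < δ) (τ : ℍ) : ((natMulPt δ hδ τ : ℍ) : ℂ) = (δ : ℂ) * τ := rfl

/-- The matrix `γ_δ = (a, bδ; c/δ, d) ∈ SL₂(ℤ)` conjugate to `γ = (a b; c d)` by `diag(δ, 1)`
(`c = δ c'`). [folklore] -/
def conjDelta (γ : SL(2, ℤ)) (δ : ℕ) (c' : ℤ) (hc : γ 1 0 = δ * c') : SL(2, ℤ) :=
  ⟨!![γ 0 0, γ 0 1 * δ; c', γ 1 1], by
    have hdet := det_entries γ
    rw [Matrix.det_fin_two_of]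
    linear_combination hdet + γ 0 1 * hc⟩

/-- Entries of `γ_δ`. [folklore] -/
theorem conjDelta_apply (γ : SL(2, ℤ)) (δ : ℕ) (c' : ℤ) (hc : γ 1 0 = δ * c') :
    conjDelta γ δ c' hc 0 0 = γ 0 0 ∧ conjDelta γ δ c' hc 0 1 = γ 0 1 * δ ∧
      conjDelta γ δ c' hc 1 0 = c' ∧ conjDelta γ δ c' hc 1 1 = γ 1 1 := by
  simp [conjDelta]

/-- **`δ · γτ = γ_δ (δτ)`.** [folklore] -/
theorem natMul_coe_SL2_smul (γ : SL(2, ℤ)) (δ : ℕ) (hδ : 0 < δ) (c' : ℤ) (hc : γ 1 0 = δ * c')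
    (τ : ℍ) : (δ : ℂ) * ((γ • τ : ℍ) : ℂ) = ((conjDelta γ δ c' hc • natMulPt δ hδ τ : ℍ) : ℂ) := by
  obtain ⟨h00, h01, h10, h11⟩ := conjDelta_apply γ δ c' hc
  rw [coe_SL2_smul, coe_SL2_smul, h00, h01, h10, h11, coe_natMulPt]
  have hden := SL2_denom_ne_zero γ τ
  have hc' : ((γ 1 0 : ℤ) : ℂ) = δ * c' := by exact_mod_cast hc
  rw [hc'] at hden ⊢
  have hden2 : (c' : ℂ) * ((δ : ℂ) * τ) + (γ 1 1 : ℤ) ≠ 0 := by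
    intro h; apply hden; linear_combination h
  rw [← mul_div_assoc, div_eq_div_iff hden hden2]
  push_cast
  ring

/-- **Newman's exponent congruence**: with `S₁ = Σ δ r_δ ≡ 0`, `S₂ = Σ (N/δ) r_δ ≡ 0 (mod 24)`,
`Σ r_δ = 2k` with `k` even and `d` odd,
`Σ_δ r_δ P₂(a, bδ, c'(N/δ), d) ≡ 0 (mod 24)` where `P₂` is the second Petersson–Knopp exponent;
indeed the sum equals `[(a - 2d)c' - bd c'² N] S₂ + bd S₁ + 6k(d - 1)`. [folklore] -/
theorem newman_exponent_sum_dvd (N : ℕ) (r : ℕ → ℤ) (k : ℤ) (hkeven : Even k)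
    (hk : ∑ δ ∈ N.divisors, r δ = 2 * k) (h1 : (24 : ℤ) ∣ ∑ δ ∈ N.divisors, (δ : ℤ) * r δ)
    (h2 : (24 : ℤ) ∣ ∑ δ ∈ N.divisors, ((N / δ : ℕ) : ℤ) * r δ) (a b c' d : ℤ) (hd : Odd d) :
    (24 : ℤ) ∣ ∑ δ ∈ N.divisors, r δ * etaP₂ a (b * δ) (c' * (N / δ : ℕ)) d := by
  have hpt : ∀ δ ∈ N.divisors, r δ * etaP₂ a (b * δ) (c' * (N / δ : ℕ)) d =
      ((a - 2 * d) * c' - b * d * c' ^ 2 * N) * (((N / δ : ℕ) : ℤ) * r δ) + b * d * ((δ : ℤ) * r δ)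
        + (3 * d - 3) * r δ := fun δ hδ ↦ by
    have hNδ : (δ : ℤ) * ((N / δ : ℕ) : ℤ) = N := by
      exact_mod_cast Nat.mul_div_cancel' (Nat.dvd_of_mem_divisors hδ)
    unfold etaP₂
    linear_combination (-(b * d * c' ^ 2 * ((N / δ : ℕ) : ℤ) * r δ)) * hNδ
  rw [Finset.sum_congr rfl hpt, Finset.sum_add_distrib, Finset.sum_add_distrib, ← Finset.mul_sum,
    ← Finset.mul_sum, ← Finset.mul_sum, hk]
  refine dvd_add (dvd_add (Dvd.dvd.mul_left h2 _) (Dvd.dvd.mul_left h1 _)) ?_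
  obtain ⟨k', rfl⟩ := hkeven
  obtain ⟨d', rfl⟩ := hd
  exact ⟨k' * d', by ring⟩

/-- For `u = ±1` (in `ℂ`), `u^r = u^{|r|}`. [folklore] -/
theorem unit_zpow_eq_pow_natAbs {u : ℂ} (hu : u * u = 1) (z : ℤ) : u ^ z = u ^ z.natAbs := by
  rcases Int.natAbs_eq z with h | h
  · conv_lhs => rw [h]
    exact zpow_natCast u _
  · conv_lhs => rw [h]
    rw [zpow_neg, zpow_natCast, ← inv_pow, show u⁻¹ = u from inv_eq_of_mul_eq_one_right hu]

/-- `∏_δ J(δ | m)^{n_δ} = J(∏ δ^{n_δ} | m)`. [folklore] -/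
theorem prod_jacobiSym_pow (s : Finset ℕ) (n : ℕ → ℕ) (m : ℕ) :
    ∏ δ ∈ s, J((δ : ℤ) | m) ^ (n δ) = J(((∏ δ ∈ s, δ ^ (n δ) : ℕ) : ℤ) | m) := by
  induction s using Finset.induction_on with
  | empty => simp
  | insert a s ha ih =>
    rw [Finset.prod_insert ha, Finset.prod_insert ha, ih, Nat.cast_mul, jacobiSym.mul_left,
      Nat.cast_pow, jacobiSym.pow_left]

/-- **Newman's Jacobi-symbol identity**: for `gcd(c, d) = 1`, `d` odd, `N ∣ c`, `Σ r_δ` even and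
`∏ δ^{|r_δ|}` a square, `∏_δ (c_δ/|d|)^{r_δ} = 1` where `c = δ c_δ`; indeed
`(c_δ/|d|) = (c/|d|)(δ/|d|)` and `∏ (δ/|d|)^{r_δ} = (∏ δ^{|r_δ|}/|d|) = (t²/|d|) = 1`. [folklore] -/
theorem newman_jacobi_prod_eq_one (N : ℕ) (r : ℕ → ℤ) (k : ℤ)
    (hk : ∑ δ ∈ N.divisors, r δ = 2 * k) (hsq : IsSquare (∏ δ ∈ N.divisors, δ ^ (r δ).natAbs))
    (c d : ℤ) (hNc : (N : ℤ) ∣ c) (hcop : IsCoprime c d) (hd : Odd d) (cδ : ℕ → ℤ)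
    (hcδ : ∀ δ ∈ N.divisors, c = δ * cδ δ) :
    ∏ δ ∈ N.divisors, ((J(cδ δ | d.natAbs) : ℤ) : ℂ) ^ (r δ) = 1 := by
  set m := d.natAbs with hm
  have hmodd : Odd m := Int.natAbs_odd.mpr hd
  haveI : NeZero m := ⟨fun h ↦ by rw [h] at hmodd; exact absurd hmodd (by decide)⟩
  -- `u = (c/|d|) = ±1`
  have hcg : c.gcd m = 1 := by
    have : Int.gcd c d = 1 := Int.isCoprime_iff_gcd_eq_one.mp hcop
    simpa [Int.gcd, hm, Int.natAbs_abs] using this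
  have hu : J(c | m) * J(c | m) = 1 := by
    rcases jacobiSym.eq_one_or_neg_one hcg with h | h <;> rw [h] <;> norm_num
  -- each `δ ∣ N` is coprime to `d`
  have hδcop : ∀ δ ∈ N.divisors, IsCoprime (δ : ℤ) d := fun δ hδ ↦
    hcop.of_isCoprime_of_dvd_left
      ((Int.natCast_dvd_natCast.mpr (Nat.dvd_of_mem_divisors hδ)).trans hNc)
  have hw : ∀ δ ∈ N.divisors, J((δ : ℤ) | m) * J((δ : ℤ) | m) = 1 := fun δ hδ ↦ by
    have hg : (δ : ℤ).gcd m = 1 := by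
      have := Int.isCoprime_iff_gcd_eq_one.mp (hδcop δ hδ)
      simpa [Int.gcd, hm, Int.natAbs_abs] using this
    rcases jacobiSym.eq_one_or_neg_one hg with h | h <;> rw [h] <;> norm_num
  -- `(c_δ/|d|) = (c/|d|)(δ/|d|)`
  have hfac : ∀ δ ∈ N.divisors, J(cδ δ | m) = J(c | m) * J((δ : ℤ) | m) := fun δ hδ ↦ by
    have : J(c | m) = J((δ : ℤ) | m) * J(cδ δ | m) := by rw [hcδ δ hδ, jacobiSym.mul_left]
    rw [this]
    linear_combination (-J(cδ δ | m)) * hw δ hδ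
  rw [Finset.prod_congr rfl fun δ hδ ↦ by rw [hfac δ hδ]]
  simp_rw [Int.cast_mul, mul_zpow, Finset.prod_mul_distrib]
  -- the `(c/|d|)` part: `u^{Σ r} = (u²)^k = 1`
  have huC : ((J(c | m) : ℤ) : ℂ) * ((J(c | m) : ℤ) : ℂ) = 1 := by exact_mod_cast hu
  have h1 : ∏ δ ∈ N.divisors, ((J(c | m) : ℤ) : ℂ) ^ (r δ) = 1 := by
    have hne : ((J(c | m) : ℤ) : ℂ) ≠ 0 := fun h ↦ by rw [h, zero_mul] at huC; exact zero_ne_one huC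
    rw [show (∏ δ ∈ N.divisors, ((J(c | m) : ℤ) : ℂ) ^ (r δ)) =
        ((J(c | m) : ℤ) : ℂ) ^ (∑ δ ∈ N.divisors, r δ) by
      induction N.divisors using Finset.induction_on with
      | empty => simp
      | insert a s ha ih => rw [Finset.prod_insert ha, Finset.sum_insert ha, ih, zpow_add₀ hne],
      hk, two_mul, zpow_add₀ hne, ← mul_zpow, huC, one_zpow]
  -- the `(δ/|d|)` part: `∏ (δ/|d|)^{|r_δ|} = (t²/|d|) = 1`
  have h2 : ∏ δ ∈ N.divisors, ((J((δ : ℤ) | m) : ℤ) : ℂ) ^ (r δ) = 1 := by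
    rw [Finset.prod_congr rfl fun δ hδ ↦ unit_zpow_eq_pow_natAbs (by exact_mod_cast hw δ hδ) (r δ)]
    have : (∏ δ ∈ N.divisors, ((J((δ : ℤ) | m) : ℤ) : ℂ) ^ (r δ).natAbs) =
        ((∏ δ ∈ N.divisors, J((δ : ℤ) | m) ^ (r δ).natAbs : ℤ) : ℂ) := by push_cast; rfl
    rw [this, prod_jacobiSym_pow]
    obtain ⟨t, ht⟩ := hsq
    rw [ht]
    have htcop : IsCoprime (t : ℤ) d := by
      have hprod : IsCoprime ((∏ δ ∈ N.divisors, δ ^ (r δ).natAbs : ℕ) : ℤ) d := by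
        rw [Nat.cast_prod]
        exact IsCoprime.prod_left fun δ hδ ↦ by
          rw [Nat.cast_pow]; exact (hδcop δ hδ).pow_left
      rw [ht, Nat.cast_mul] at hprod
      exact hprod.of_mul_left_left
    have htg : (t : ℤ).gcd m = 1 := by
      have := Int.isCoprime_iff_gcd_eq_one.mp htcop
      simpa [Int.gcd, hm, Int.natAbs_abs] using this
    rw [show ((t * t : ℕ) : ℤ) = (t : ℤ) ^ 2 by push_cast; ring, jacobiSym.sq_one' htg]
    simp
  rw [h1, h2, mul_one]

/-- **Newman's criterion, core case** (Newman 1959; Ligozat; Ono, *Web of modularity*,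
Thm. 1.64): let `f = ∏_{δ ∣ N} η(δτ)^{r_δ}` with `Σ δ r_δ ≡ 0 (mod 24)`, `Σ (N/δ) r_δ ≡ 0 (mod 24)`,
`Σ r_δ = 2k` with `k` even and `∏ δ^{|r_δ|}` a perfect square. Then for
`γ = (a b; c d) ∈ Γ₀(N)` with `c > 0` and `d` odd, `f(γτ) = (cτ + d)^k f(τ)`. Proof: by the
transformation law of `η` (`eta_SL2_smul`) applied to the conjugates `γ_δ = (a, bδ; c/δ, d)`,
`f(γτ) = [∏_δ v_η(γ_δ)^{r_δ}] (cτ + d)^k f(τ)`, and the bracket is `1` by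
`newman_jacobi_prod_eq_one` and `newman_exponent_sum_dvd`. This is the sufficiency half of the
Newman criterion as stated in Savitt 2025, Thm. 1, for trivial character.
[cite: Savitt2025, Thm. 1] -/
theorem etaQuotient_SL2_smul_of_odd (N : ℕ) (hN : 0 < N) (r : ℕ → ℤ) (k : ℤ) (hkeven : Even k)
    (hk : ∑ δ ∈ N.divisors, r δ = 2 * k)
    (h1 : (24 : ℤ) ∣ ∑ δ ∈ N.divisors, (δ : ℤ) * r δ)
    (h2 : (24 : ℤ) ∣ ∑ δ ∈ N.divisors, ((N / δ : ℕ) : ℤ) * r δ)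
    (hsq : IsSquare (∏ δ ∈ N.divisors, δ ^ (r δ).natAbs))
    (γ : SL(2, ℤ)) (hγN : (N : ℤ) ∣ γ 1 0) (hc : 0 < γ 1 0) (hd : Odd (γ 1 1)) (τ : ℍ) :
    etaQuotient N r (γ • τ) = ((γ 1 0 : ℂ) * τ + γ 1 1) ^ k * etaQuotient N r τ := by
  obtain ⟨cN, hcN⟩ := hγN
  have hcNpos : 0 < cN := by
    rcases lt_trichotomy cN 0 with h | h | h
    · nlinarith [hcN]
    · rw [h, mul_zero] at hcN; omega
    · exact h
  -- the conjugates `γ_δ`, `c/δ = cN (N/δ)`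
  have hcδ : ∀ δ ∈ N.divisors, γ 1 0 = δ * (cN * (N / δ : ℕ)) := fun δ hδ ↦ by
    have hNδ : ((δ : ℕ) : ℤ) * ((N / δ : ℕ) : ℤ) = N := by
      exact_mod_cast Nat.mul_div_cancel' (Nat.dvd_of_mem_divisors hδ)
    rw [hcN, ← hNδ]; ring
  have hcδpos : ∀ δ ∈ N.divisors, 0 < cN * (N / δ : ℕ) := fun δ hδ ↦
    mul_pos hcNpos (by exact_mod_cast Nat.div_pos (Nat.divisor_le hδ) (Nat.pos_of_mem_divisors hδ))
  set j : ℂ := (γ 1 0 : ℂ) * τ + γ 1 1 with hj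
  have hjne : j ≠ 0 := SL2_denom_ne_zero γ τ
  -- each factor
  have hfactor : ∀ δ ∈ N.divisors, η (δ * ((γ • τ : ℍ) : ℂ)) =
      etaMultiplier (γ 0 0) (γ 0 1 * δ) (cN * (N / δ : ℕ)) (γ 1 1) * Complex.sqrt j *
        η (δ * (τ : ℂ)) := fun δ hδ ↦ by
    have hδ0 := Nat.pos_of_mem_divisors hδ
    obtain ⟨h00, h01, h10, h11⟩ := conjDelta_apply γ δ _ (hcδ δ hδ)
    have := eta_SL2_smul (conjDelta γ δ _ (hcδ δ hδ)) (Or.inl (by rw [h10]; exact hcδpos δ hδ))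
      (natMulPt δ hδ0 τ)
    rw [natMul_coe_SL2_smul γ δ hδ0 _ (hcδ δ hδ), this, etaMultiplierSL, h00, h01, h10, h11,
      coe_natMulPt]
    congr 2
    rw [hj]
    have : ((γ 1 0 : ℤ) : ℂ) = δ * (cN * (N / δ : ℕ) : ℤ) := by exact_mod_cast hcδ δ hδ
    rw [this]; push_cast; ring
  rw [etaQuotient_apply, etaQuotient_apply, Finset.prod_congr rfl fun δ hδ ↦ by rw [hfactor δ hδ]]
  simp_rw [mul_zpow, Finset.prod_mul_distrib]
  -- the automorphy factors: `∏ (√j)^{r_δ} = (√j)^{2k} = j^k`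
  have hsqrt : ∏ δ ∈ N.divisors, Complex.sqrt j ^ (r δ) = j ^ k := by
    have hsne : Complex.sqrt j ≠ 0 := fun h ↦ hjne (by rw [← csqrt_sq j, h]; simp)
    rw [show (∏ δ ∈ N.divisors, Complex.sqrt j ^ (r δ)) =
        Complex.sqrt j ^ (∑ δ ∈ N.divisors, r δ) by
      induction N.divisors using Finset.induction_on with
      | empty => simp
      | insert a s ha ih => rw [Finset.prod_insert ha, Finset.sum_insert ha, ih, zpow_add₀ hsne],
      hk, zpow_mul, show Complex.sqrt j ^ (2 : ℤ) = j by
        rw [show (2 : ℤ) = ((2 : ℕ) : ℤ) from rfl, zpow_natCast, csqrt_sq]]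
  -- the multipliers: Jacobi part and exponential part
  have hmult : ∏ δ ∈ N.divisors,
      etaMultiplier (γ 0 0) (γ 0 1 * δ) (cN * (N / δ : ℕ)) (γ 1 1) ^ (r δ) = 1 := by
    rw [Finset.prod_congr rfl fun δ hδ ↦ by
      rw [etaMultiplier_of_odd_d (hcδpos δ hδ) hd, mul_zpow, ← Complex.exp_int_mul]]
    rw [Finset.prod_mul_distrib, ← Complex.exp_sum]
    have hcop : IsCoprime (γ 1 0) (γ 1 1) := by
      refine ⟨γ 1 1 * 0 + -γ 0 1, γ 0 0, ?_⟩
      linear_combination det_entries γ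
    rw [newman_jacobi_prod_eq_one N r k hk hsq (γ 1 0) (γ 1 1) ⟨cN, hcN⟩ hcop hd
      (fun δ ↦ cN * (N / δ : ℕ)) hcδ, one_mul]
    obtain ⟨t, ht⟩ := newman_exponent_sum_dvd N r k hkeven hk h1 h2 (γ 0 0) (γ 0 1) cN (γ 1 1) hd
    rw [show (∑ δ ∈ N.divisors, (r δ : ℂ) * (π * I / 12 *
        (etaP₂ (γ 0 0) (γ 0 1 * δ) (cN * (N / δ : ℕ)) (γ 1 1) : ℤ))) = (t : ℂ) * (2 * π * I) by
      rw [show (t : ℂ) * (2 * π * I) = π * I / 12 * ((24 * t : ℤ) : ℂ) by push_cast; ring, ← ht,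
        Int.cast_sum, Finset.mul_sum]
      exact Finset.sum_congr rfl fun δ _ ↦ by push_cast; ring]
    exact Complex.exp_int_mul_two_pi_mul_I t
  rw [hmult, hsqrt, one_mul]

/-! ### `Γ₀(N)`-invariance in even weight and the cusp forms `∏ η(δτ)^{r_δ}` -/

/-- Newman's hypotheses on an exponent vector `r` at level `N` in weight `k`:
`Σ r_δ = 2k`, `Σ δ r_δ ≡ 0 (mod 24)`, `Σ (N/δ) r_δ ≡ 0 (mod 24)`, `∏ δ^{|r_δ|}` a square.
[folklore] -/
structure NewmanCond (N : ℕ) (r : ℕ → ℤ) (k : ℤ) : Prop where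
  /-- the weight condition `Σ r_δ = 2k` -/
  sum_eq : ∑ δ ∈ N.divisors, r δ = 2 * k
  /-- Newman's first congruence `Σ δ r_δ ≡ 0 (mod 24)` -/
  sum_mul_dvd : (24 : ℤ) ∣ ∑ δ ∈ N.divisors, (δ : ℤ) * r δ
  /-- Newman's second congruence `Σ (N/δ) r_δ ≡ 0 (mod 24)` -/
  sum_div_dvd : (24 : ℤ) ∣ ∑ δ ∈ N.divisors, ((N / δ : ℕ) : ℤ) * r δ
  /-- `∏ δ^{|r_δ|}` is a perfect square (trivial character) -/
  isSquare : IsSquare (∏ δ ∈ N.divisors, δ ^ (r δ).natAbs)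

/-- `η`-quotients are `1`-periodic under Newman's first congruence, on `ℍ`. [folklore] -/
theorem etaQuotient_of_coe_eq_add_intCast (N : ℕ) (r : ℕ → ℤ)
    (h : (24 : ℤ) ∣ ∑ δ ∈ N.divisors, (δ : ℤ) * r δ) {σ τ : ℍ} {n : ℤ}
    (hστ : (σ : ℂ) = (τ : ℂ) + n) : etaQuotient N r σ = etaQuotient N r τ := by
  rw [etaQuotient, etaQuotient, hστ, etaQuotientC_add_intCast_of_dvd N r h]

/-- **Newman's criterion on all of `Γ₀(N)` (even weight)**: under `NewmanCond N r k` with `k`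
even, `f(γτ) = (cτ + d)^k f(τ)` for every `γ ∈ Γ₀(N)`. The cases `c < 0` and `c = 0` reduce to
`c > 0` and to periodicity (`-1 ∈ Γ₀(N)` acts through `(-1)^k = 1`), and `d` even reduces to
`d` odd via `γ = (γT⁻¹)T`. [cite: Savitt2025, Thm. 1] -/
theorem etaQuotient_smul_of_mem_Gamma0 (N : ℕ) (hN : 0 < N) (r : ℕ → ℤ) (k : ℤ) (hkeven : Even k)
    (hc : NewmanCond N r k) {γ : SL(2, ℤ)} (hγ : γ ∈ Gamma0 N) (τ : ℍ) :
    etaQuotient N r (γ • τ) = ((γ 1 0 : ℂ) * τ + γ 1 1) ^ k * etaQuotient N r τ := by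
  obtain ⟨hk, h1, h2, hsq⟩ := hc
  have hdvd_of_mem : ∀ {γ : SL(2, ℤ)}, γ ∈ Gamma0 N → (N : ℤ) ∣ γ 1 0 := fun hγ ↦ by
    rw [Gamma0_mem] at hγ
    exact (ZMod.intCast_zmod_eq_zero_iff_dvd _ N).mp hγ
  -- positive `c`, any `d`
  have aux : ∀ (γ : SL(2, ℤ)), (N : ℤ) ∣ γ 1 0 → 0 < γ 1 0 → ∀ τ : ℍ,
      etaQuotient N r (γ • τ) = ((γ 1 0 : ℂ) * τ + γ 1 1) ^ k * etaQuotient N r τ := by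
    intro γ hNc hcpos τ
    rcases Int.even_or_odd (γ 1 1) with hde | hdo
    · -- `d` even: `γ = (γ T⁻¹) T` with `d - c` odd
      obtain ⟨h00, h01, h10, h11⟩ := coe_mul_T_inv γ
      have hco : Odd (γ 1 0) := by
        by_contra h
        rw [Int.not_odd_iff_even] at h
        have : Even (γ 0 0 * γ 1 1 - γ 0 1 * γ 1 0) := (hde.mul_left _).sub (h.mul_left _)
        rw [det_entries] at this
        exact Int.not_even_one this
      have hdo' : Odd ((γ * ModularGroup.T⁻¹) 1 1) := by
        rw [h11, Int.odd_sub']; exact iff_of_true hco hde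
      have hγ₁ := etaQuotient_SL2_smul_of_odd N hN r k hkeven hk h1 h2 hsq (γ * ModularGroup.T⁻¹)
        (by rw [h10]; exact hNc) (by rw [h10]; exact hcpos) hdo' (ModularGroup.T • τ)
      rw [← mul_smul, inv_mul_cancel_right, h10, h11] at hγ₁
      have hT : ((ModularGroup.T • τ : ℍ) : ℂ) = (τ : ℂ) + (1 : ℤ) := by
        rw [modular_T_smul, coe_vadd]; push_cast; ring
      rw [hγ₁, etaQuotient_of_coe_eq_add_intCast N r h1 hT, hT]
      push_cast
      ring
    · exact etaQuotient_SL2_smul_of_odd N hN r k hkeven hk h1 h2 hsq γ hNc hcpos hdo τ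
  rcases lt_trichotomy (γ 1 0) 0 with hneg | hzero | hpos
  · -- `c < 0`: use `-γ`
    have h := aux (-γ) (by rw [SL_neg_apply]; exact (hdvd_of_mem hγ).neg_right)
      (by rw [SL_neg_apply]; linarith) τ
    rw [SL_neg_apply, SL_neg_apply, show (-γ) • τ = γ • τ by simp] at h
    rw [h]
    push_cast
    rw [show (-(γ 1 0 : ℂ) * τ + -(γ 1 1 : ℂ)) = -((γ 1 0 : ℂ) * τ + γ 1 1) by ring,
      Even.neg_zpow hkeven]
  · -- `c = 0`: `γ = ±Tⁿ`
    have hdet := det_entries γ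
    rcases SL2Z_d_of_c_eq_zero γ hzero with hd | hd
    · have ha : γ 0 0 = 1 := by rw [hzero, hd] at hdet; linarith
      have hcoe : ((γ • τ : ℍ) : ℂ) = (τ : ℂ) + (γ 0 1 : ℤ) := by
        rw [coe_SL2_smul, ha, hzero, hd]; push_cast; ring
      rw [etaQuotient_of_coe_eq_add_intCast N r h1 hcoe, hzero, hd]
      simp
    · have ha : γ 0 0 = -1 := by rw [hzero, hd] at hdet; linarith
      have hcoe : ((γ • τ : ℍ) : ℂ) = (τ : ℂ) + ((-γ 0 1 : ℤ) : ℂ) := by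
        rw [coe_SL2_smul, ha, hzero, hd]; push_cast; ring
      rw [etaQuotient_of_coe_eq_add_intCast N r h1 hcoe, hzero, hd]
      push_cast
      rw [zero_mul, zero_add, Even.neg_one_zpow hkeven, one_mul]
  · exact aux γ (hdvd_of_mem hγ) hpos τ

/-- **Slash invariance**: `f|_k γ = f` for `γ ∈ Γ₀(N)` under Newman's conditions, `k` even.
[folklore] -/
theorem etaQuotient_slash_of_mem_Gamma0 (N : ℕ) (hN : 0 < N) (r : ℕ → ℤ) (k : ℤ)
    (hkeven : Even k) (hc : NewmanCond N r k) {γ : SL(2, ℤ)} (hγ : γ ∈ Gamma0 N) :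
    etaQuotient N r ∣[k] γ = etaQuotient N r := by
  funext τ
  rw [SL_slash_apply, ModularGroup.denom_apply,
    etaQuotient_smul_of_mem_Gamma0 N hN r k hkeven hc hγ,
    mul_comm (_ ^ k), mul_assoc, ← zpow_add₀ (SL2_denom_ne_zero γ τ), add_neg_cancel, zpow_zero,
    mul_one]

/-- The order quantity `cuspOrder24 N r c` only depends on `gcd(N, c)`. [folklore] -/
theorem cuspOrder24_eq_gcd (N : ℕ) (r : ℕ → ℤ) (c : ℤ) :
    cuspOrder24 N r c = cuspOrder24 N r (Nat.gcd N c.natAbs : ℕ) := by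
  unfold cuspOrder24
  refine Finset.sum_congr rfl fun δ hδ ↦ ?_
  have : Int.gcd (δ : ℤ) c = Int.gcd (δ : ℤ) ((Nat.gcd N c.natAbs : ℕ) : ℤ) := by
    simp only [Int.gcd, Int.natAbs_natCast]
    rw [← Nat.gcd_assoc, Nat.gcd_eq_left (Nat.dvd_of_mem_divisors hδ)]
  rw [this]

/-- **The cusp form `∏_{δ ∣ N} η(δτ)^{r_δ} ∈ S_k(Γ₀(N))`** attached to an exponent vector
satisfying Newman's conditions (invariance), with `k` even, and Ligozat's positivity at every
cusp (`cuspOrder24 N r t > 0` for all `t ∣ N`). [folklore] -/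
def etaQuotientCuspForm (N : ℕ) [NeZero N] (r : ℕ → ℤ) (k : ℤ) (hkeven : Even k)
    (hc : NewmanCond N r k) (hord : ∀ t ∈ N.divisors, 0 < cuspOrder24 N r t) :
    CuspForm (Gamma0 N) k where
  toFun := etaQuotient N r
  slash_action_eq' A hA := by
    obtain ⟨γ, hγ, rfl⟩ := hA
    exact etaQuotient_slash_of_mem_Gamma0 N (NeZero.pos N) r k hkeven hc hγ
  holo' := mdifferentiable_etaQuotient N r
  zero_at_cusps' hcusp := by
    rw [Subgroup.IsArithmetic.isCusp_iff_isCusp_SL2Z] at hcusp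
    rw [OnePoint.isZeroAt_iff_forall_SL2Z hcusp]
    intro γ _
    refine isZeroAtImInfty_etaQuotient_slash N (NeZero.pos N) r k hc.sum_eq γ ?_
    rw [cuspOrder24_eq_gcd]
    exact hord _ (Nat.mem_divisors.mpr ⟨Nat.gcd_dvd_left _ _, NeZero.ne N⟩)

/-- The underlying function. [folklore] -/
theorem coe_etaQuotientCuspForm (N : ℕ) [NeZero N] (r : ℕ → ℤ) (k : ℤ) (hkeven : Even k)
    (hc : NewmanCond N r k) (hord : ∀ t ∈ N.divisors, 0 < cuspOrder24 N r t) :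
    (etaQuotientCuspForm N r k hkeven hc hord : ℍ → ℂ) = etaQuotient N r := rfl

/-! ### Linear independence from distinct orders at `∞` -/

/-- Evaluation of a finite sum of cusp forms. [folklore] -/
theorem CuspForm_sum_apply {ι : Type*} {Γ : Subgroup SL(2, ℤ)} {k : ℤ} (s : Finset ι)
    (G : ι → CuspForm Γ k) (τ : ℍ) : (∑ i ∈ s, G i) τ = ∑ i ∈ s, G i τ := by
  classical
  induction s using Finset.induction_on with
  | empty => simp
  | insert a s ha ih => rw [Finset.sum_insert ha, Finset.sum_insert ha, CuspForm.add_apply, ih]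

/-- `e^{2πi τ}^m → 0` as `Im τ → ∞` for `m ≥ 1`. [folklore] -/
theorem tendsto_qParam_zpow_atImInfty {m : ℤ} (hm : 0 < m) :
    Tendsto (fun τ : ℍ ↦ Function.Periodic.qParam 1 (τ : ℂ) ^ m) atImInfty (𝓝 0) := by
  obtain ⟨n, rfl⟩ := Int.eq_ofNat_of_zero_le hm.le
  have hn : n ≠ 0 := by rintro rfl; simp at hm
  simp_rw [zpow_natCast]
  simpa [zero_pow hn] using (UpperHalfPlane.qParam_tendsto_atImInfty one_pos).pow n

/-- **Functions with pairwise distinct leading exponents at `i∞` are linearly independent**: if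
`F_i(τ)/e^{2πi n_i τ} → 1` (`Im τ → ∞`) with `i ↦ n_i` injective, then the cusp forms `F_i` are
linearly independent. [folklore] -/
theorem linearIndependent_of_tendsto_div_qParam_zpow {ι : Type*} {Γ : Subgroup SL(2, ℤ)} {k : ℤ}
    (F : ι → CuspForm Γ k) (n : ι → ℤ) (hn : Function.Injective n)
    (hF : ∀ i, Tendsto (fun τ : ℍ ↦ F i τ / Function.Periodic.qParam 1 (τ : ℂ) ^ (n i)) atImInfty
      (𝓝 1)) :
    LinearIndependent ℂ F := by
  classical
  rw [linearIndependent_iff']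
  suffices ∀ (m : ℕ) (s : Finset ι), s.card = m → ∀ g : ι → ℂ, ∑ i ∈ s, g i • F i = 0 →
      ∀ i ∈ s, g i = 0 from fun s g hg ↦ this _ s rfl g hg
  intro m
  induction m with
  | zero => intro s hs g _ i hi; rw [Finset.card_eq_zero.mp hs] at hi; simp at hi
  | succ m ih =>
    intro s hs g hg
    have hne : s.Nonempty := Finset.card_pos.mp (by omega)
    obtain ⟨i₀, hi₀, hmin⟩ := Finset.exists_min_image s n hne
    -- evaluate, divide by `q^{n i₀}` and let `Im τ → ∞`
    have hq : ∀ τ : ℍ, Function.Periodic.qParam 1 (τ : ℂ) ≠ 0 := fun τ ↦ by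
      simp [Function.Periodic.qParam, Complex.exp_ne_zero]
    have hsum : ∀ τ : ℍ, ∑ i ∈ s, g i * (F i τ / Function.Periodic.qParam 1 (τ : ℂ) ^ (n i)) *
        Function.Periodic.qParam 1 (τ : ℂ) ^ (n i - n i₀) = 0 := fun τ ↦ by
      have h := congrArg (fun f : CuspForm Γ k ↦ f τ) hg
      simp only [CuspForm_sum_apply, CuspForm.IsGLPos.smul_apply, smul_eq_mul,
        CuspForm.zero_apply] at h
      have : ∑ i ∈ s, g i * (F i τ / Function.Periodic.qParam 1 (τ : ℂ) ^ (n i)) *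
          Function.Periodic.qParam 1 (τ : ℂ) ^ (n i - n i₀) =
          (∑ i ∈ s, g i * F i τ) * (Function.Periodic.qParam 1 (τ : ℂ) ^ (n i₀))⁻¹ := by
        rw [Finset.sum_mul]
        refine Finset.sum_congr rfl fun i _ ↦ ?_
        have hqi : Function.Periodic.qParam 1 (τ : ℂ) ^ (n i) ≠ 0 := zpow_ne_zero _ (hq τ)
        have hq0 : Function.Periodic.qParam 1 (τ : ℂ) ^ (n i₀) ≠ 0 := zpow_ne_zero _ (hq τ)
        rw [zpow_sub₀ (hq τ)]
        field_simp
      rw [this, h, zero_mul]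
    have hlim : Tendsto (fun τ : ℍ ↦ ∑ i ∈ s,
        g i * (F i τ / Function.Periodic.qParam 1 (τ : ℂ) ^ (n i)) *
          Function.Periodic.qParam 1 (τ : ℂ) ^ (n i - n i₀)) atImInfty
        (𝓝 (∑ i ∈ s, g i * 1 * if i = i₀ then 1 else 0)) := by
      refine tendsto_finsetSum s fun i hi ↦ ((hF i).const_mul (g i)).mul ?_
      split_ifs with h
      · subst h; simp
      · have : 0 < n i - n i₀ := by
          have := hmin i hi
          have hne' : n i ≠ n i₀ := fun e ↦ h (hn e)
          omega
        exact tendsto_qParam_zpow_atImInfty this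
    rw [show (fun τ : ℍ ↦ ∑ i ∈ s, g i * (F i τ / Function.Periodic.qParam 1 (τ : ℂ) ^ (n i)) *
        Function.Periodic.qParam 1 (τ : ℂ) ^ (n i - n i₀)) = fun _ ↦ 0 from funext hsum] at hlim
    simp only [mul_one, mul_ite, mul_zero, Finset.sum_ite_eq', if_pos hi₀] at hlim
    have hg₀ : g i₀ = 0 := (tendsto_const_nhds_iff.mp hlim).symm
    -- remove `i₀` and induct
    intro i hi
    by_cases hii : i = i₀
    · rw [hii]; exact hg₀
    · refine ih (s.erase i₀) (by rw [Finset.card_erase_of_mem hi₀, hs]; rfl) g ?_ i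
        (Finset.mem_erase.mpr ⟨hii, hi⟩)
      rw [← Finset.sum_erase_add _ _ hi₀, hg₀, zero_smul, add_zero] at hg
      exact hg

/-- **Lower bound for `dim S₂(Γ₀(N))` from `η`-quotients with distinct orders at `∞`.**
[folklore] -/
theorem le_finrank_of_etaQuotients (N : ℕ) [NeZero N] {ι : Type*} [Fintype ι] (r : ι → ℕ → ℤ)
    (hc : ∀ i, NewmanCond N (r i) 2) (hord : ∀ i, ∀ t ∈ N.divisors, 0 < cuspOrder24 N (r i) t)
    (n : ι → ℤ) (hn : Function.Injective n)
    (hlead : ∀ i, ∑ δ ∈ N.divisors, (δ : ℤ) * r i δ = 24 * n i) :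
    Fintype.card ι ≤ Module.finrank ℂ (CuspForm (Gamma0 N) 2) := by
  have hfd : FiniteDimensional ℂ (CuspForm (Gamma0 N) 2) := finiteDimensional_cuspForm_gamma0 N 2
  have hli := linearIndependent_of_tendsto_div_qParam_zpow
    (fun i ↦ etaQuotientCuspForm N (r i) 2 (by decide) (hc i) (hord i)) n hn
    (fun i ↦ tendsto_etaQuotient_div_qParam_zpow N (r i) (n i) (hlead i))
  exact hli.fintype_card_le_finrank

/-! ### Certificates: a decidable sufficient condition, checked by `decide` level by level -/

/-- The exponent vector encoded by a list of pairs `(δ, r_δ)`. [folklore] -/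
def expFn (L : List (ℕ × ℤ)) (δ : ℕ) : ℤ := (L.map fun p ↦ if p.1 = δ then p.2 else 0).sum

/-- **Certificate for a weight-`2` `η`-quotient on `Γ₀(N)`**: Newman's conditions
(`Σ r_δ = 4`, the two congruences mod `24`, `∏ δ^{|r_δ|} = t²` with the witness `t`) and Ligozat's
positivity of the order at every cusp (`cuspOrder24 N r c > 0` for all `c ∣ N`). All clauses are
decidable. [folklore] -/
def EtaCert (N : ℕ) (L : List (ℕ × ℤ)) (t : ℕ) : Prop :=
  (∑ δ ∈ N.divisors, expFn L δ = 4) ∧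
  ((24 : ℤ) ∣ ∑ δ ∈ N.divisors, (δ : ℤ) * expFn L δ) ∧
  ((24 : ℤ) ∣ ∑ δ ∈ N.divisors, ((N / δ : ℕ) : ℤ) * expFn L δ) ∧
  (t * t = ∏ δ ∈ N.divisors, δ ^ (expFn L δ).natAbs) ∧
  (∀ c ∈ N.divisors, 0 < cuspOrder24 N (expFn L) c)

/-- `EtaCert` is decidable. [folklore] -/
instance (N : ℕ) (L : List (ℕ × ℤ)) (t : ℕ) : Decidable (EtaCert N L t) := by
  unfold EtaCert; infer_instance

/-- A certificate gives Newman's conditions in weight `2`. [folklore] -/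
theorem newmanCond_of_etaCert {N : ℕ} {L : List (ℕ × ℤ)} {t : ℕ} (h : EtaCert N L t) :
    NewmanCond N (expFn L) 2 :=
  ⟨by rw [h.1]; norm_num, h.2.1, h.2.2.1, ⟨t, h.2.2.2.1.symm⟩⟩

/-- **Lower bound for `dim S₂(Γ₀(N))` from a list of certified `η`-quotients with pairwise
distinct orders at `∞`.** [folklore] -/
theorem le_finrank_of_etaCerts (N : ℕ) [NeZero N] (Ls : List (List (ℕ × ℤ) × ℕ))
    (hcert : ∀ p ∈ Ls, EtaCert N p.1 p.2)
    (hnodup : (Ls.map fun p ↦ ∑ δ ∈ N.divisors, (δ : ℤ) * expFn p.1 δ).Nodup) :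
    Ls.length ≤ Module.finrank ℂ (CuspForm (Gamma0 N) 2) := by
  set f : List (ℕ × ℤ) × ℕ → ℤ := fun p ↦ ∑ δ ∈ N.divisors, (δ : ℤ) * expFn p.1 δ with hf
  have hmem : ∀ i : Fin Ls.length, Ls[i] ∈ Ls := fun i ↦ List.getElem_mem _
  have hdvd : ∀ i : Fin Ls.length, (24 : ℤ) ∣ f Ls[i] := fun i ↦ (hcert _ (hmem i)).2.1
  have h := le_finrank_of_etaQuotients N (fun i : Fin Ls.length ↦ expFn (Ls[i]).1)
    (fun i ↦ newmanCond_of_etaCert (hcert _ (hmem i))) (fun i ↦ (hcert _ (hmem i)).2.2.2.2)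
    (fun i ↦ f Ls[i] / 24) (fun i j hij ↦ ?_) (fun i ↦ (Int.mul_ediv_cancel' (hdvd i)).symm)
  · simpa using h
  · -- injectivity of the orders from `Nodup`
    have hfij : f Ls[i] = f Ls[j] := by
      rw [← Int.mul_ediv_cancel' (hdvd i), ← Int.mul_ediv_cancel' (hdvd j)]
      exact congrArg (24 * ·) hij
    have h1 : (Ls.map f)[(i : ℕ)]'(by simp) = (Ls.map f)[(j : ℕ)]'(by simp) := by
      simp only [List.getElem_map]
      exact hfij
    exact Fin.ext ((List.Nodup.getElem_inj_iff hnodup).mp h1)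

/-- **`dim S₂(Γ₀(N)) = g(X₀(N))` from `g(X₀(N))` certified `η`-quotients** (with Manin's upper
bound `finrank_cuspForm_two_le_genusX0`). [folklore] -/
theorem finrank_eq_genusX0_of_etaCerts (N : ℕ) [NeZero N] (Ls : List (List (ℕ × ℤ) × ℕ))
    (hcert : ∀ p ∈ Ls, EtaCert N p.1 p.2)
    (hnodup : (Ls.map fun p ↦ ∑ δ ∈ N.divisors, (δ : ℤ) * expFn p.1 δ).Nodup)
    (hg : genusX0 N = Ls.length) :
    finrank_cuspForm_two_eq_genusX0 N ∧ Module.finrank ℂ (CuspForm (Gamma0 N) 2) = Ls.length := by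
  have hle : Module.finrank ℂ (CuspForm (Gamma0 N) 2) ≤ Ls.length :=
    (finrank_cuspForm_two_le_genusX0 N).trans_eq hg
  have hge := le_finrank_of_etaCerts N Ls hcert hnodup
  have heq : Module.finrank ℂ (CuspForm (Gamma0 N) 2) = Ls.length := le_antisymm hle hge
  exact ⟨by rw [finrank_cuspForm_two_eq_genusX0, heq, hg], heq⟩

/-! ### The genera of `X₀(N)` for the new levels -/

/-- `g(X₀(14)) = 1`: `μ = 24`, `ν_∞ = 4`, `ν₂ = ν₃ = 0`. [folklore] -/
theorem genusX0_fourteen : genusX0 14 = 1 := by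
  rw [genusX0, show (14 : ℕ) = 2 * 7 from rfl, gamma0Index_mul (by norm_num),
    gamma0Index_prime Nat.prime_two, gamma0Index_prime (by norm_num), nu₂_eq_card, nu₃_eq_card]
  decide

/-- `g(X₀(15)) = 1`: `μ = 24`, `ν_∞ = 4`, `ν₂ = ν₃ = 0`. [folklore] -/
theorem genusX0_fifteen : genusX0 15 = 1 := by
  rw [genusX0, show (15 : ℕ) = 3 * 5 from rfl, gamma0Index_mul (by norm_num),
    gamma0Index_prime Nat.prime_three, gamma0Index_prime (by norm_num), nu₂_eq_card, nu₃_eq_card]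
  decide

/-- `g(X₀(24)) = 1`: `μ = 48`, `ν_∞ = 8`, `ν₂ = ν₃ = 0`. [folklore] -/
theorem genusX0_twentyFour : genusX0 24 = 1 := by
  rw [genusX0, show (24 : ℕ) = 2 ^ 3 * 3 from rfl, gamma0Index_mul (by norm_num),
    gamma0Index_prime_pow Nat.prime_two (by norm_num), gamma0Index_prime Nat.prime_three,
    nu₂_eq_card, nu₃_eq_card]
  decide

/-- `g(X₀(28)) = 2`: `μ = 48`, `ν_∞ = 6`, `ν₂ = ν₃ = 0`. [folklore] -/
theorem genusX0_twentyEight : genusX0 28 = 2 := by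
  rw [genusX0, show (28 : ℕ) = 2 ^ 2 * 7 from rfl, gamma0Index_mul (by norm_num),
    gamma0Index_prime_pow Nat.prime_two (by norm_num), gamma0Index_prime (by norm_num),
    nu₂_eq_card, nu₃_eq_card]
  decide

/-- `g(X₀(30)) = 3`: `μ = 72`, `ν_∞ = 8`, `ν₂ = ν₃ = 0`. [folklore] -/
theorem genusX0_thirty : genusX0 30 = 3 := by
  rw [genusX0, show (30 : ℕ) = 2 * (3 * 5) from rfl, gamma0Index_mul (by norm_num),
    gamma0Index_mul (by norm_num), gamma0Index_prime Nat.prime_two,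
    gamma0Index_prime Nat.prime_three, gamma0Index_prime (by norm_num), nu₂_eq_card, nu₃_eq_card]
  decide

/-- `g(X₀(33)) = 3`: `μ = 48`, `ν_∞ = 4`, `ν₂ = ν₃ = 0`. [folklore] -/
theorem genusX0_thirtyThree : genusX0 33 = 3 := by
  rw [genusX0, show (33 : ℕ) = 3 * 11 from rfl, gamma0Index_mul (by norm_num),
    gamma0Index_prime Nat.prime_three, gamma0Index_prime (by norm_num), nu₂_eq_card, nu₃_eq_card]
  decide

/-- `g(X₀(35)) = 3`: `μ = 48`, `ν_∞ = 4`, `ν₂ = ν₃ = 0`. [folklore] -/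
theorem genusX0_thirtyFive : genusX0 35 = 3 := by
  rw [genusX0, show (35 : ℕ) = 5 * 7 from rfl, gamma0Index_mul (by norm_num),
    gamma0Index_prime (by norm_num), gamma0Index_prime (by norm_num), nu₂_eq_card, nu₃_eq_card]
  decide

/-- `g(X₀(46)) = 5`: `μ = 72`, `ν_∞ = 4`, `ν₂ = 1`·`0`… precisely `ν₂ = 0`, `ν₃ = 0`. [folklore] -/
theorem genusX0_fortySix : genusX0 46 = 5 := by
  rw [genusX0, show (46 : ℕ) = 2 * 23 from rfl, gamma0Index_mul (by norm_num),
    gamma0Index_prime Nat.prime_two, gamma0Index_prime (by norm_num), nu₂_eq_card, nu₃_eq_card]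
  decide

/-- `g(X₀(54)) = 4`: `μ = 108`, `ν_∞ = 12`, `ν₂ = ν₃ = 0`. [folklore] -/
theorem genusX0_fiftyFour : genusX0 54 = 4 := by
  rw [genusX0, show (54 : ℕ) = 2 * 3 ^ 3 from rfl, gamma0Index_mul (by norm_num),
    gamma0Index_prime Nat.prime_two, gamma0Index_prime_pow Nat.prime_three (by norm_num),
    nu₂_eq_card, nu₃_eq_card]
  decide

/-- `g(X₀(64)) = 3`: `μ = 96`, `ν_∞ = 12`, `ν₂ = ν₃ = 0`. [folklore] -/
theorem genusX0_sixtyFour : genusX0 64 = 3 := by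
  rw [genusX0, show (64 : ℕ) = 2 ^ 6 from rfl, gamma0Index_prime_pow Nat.prime_two (by norm_num),
    nu₂_eq_card, nu₃_eq_card]
  decide

/-! ### The levels `14, 15, 24, 28, 30, 33, 35, 46, 54, 64` -/

/-- The `η`-quotient certificates at level `14` (exponent lists with the square-root witness),
of orders `1` at `∞`. [folklore] -/
def etaCertsFourteen : List (List (ℕ × ℤ) × ℕ) :=
  [([(1, 1), (2, 1), (7, 1), (14, 1)], 14)]

/-- **`dim S₂(Γ₀(14)) = g(X₀(14)) = 1`** (the named fact `finrank_cuspForm_two_eq_genusX0 14`,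
Diamond–Shurman Thm. 3.5.1), from `1` `η`-quotient in `S₂(Γ₀(14))` with distinct orders at `∞`
(Newman–Ligozat criterion, certified by `decide`) and Manin's bound.
[cite: DiamondShurman2005, Thm. 3.5.1] -/
theorem finrank_cuspForm_two_eq_genusX0_fourteen :
    finrank_cuspForm_two_eq_genusX0 14 ∧ Module.finrank ℂ (CuspForm (Gamma0 14) 2) = 1 :=
  finrank_eq_genusX0_of_etaCerts 14 etaCertsFourteen (by decide) (by decide) genusX0_fourteen

/-- The `η`-quotient certificates at level `15` (exponent lists with the square-root witness),
of orders `1` at `∞`. [folklore] -/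
def etaCertsFifteen : List (List (ℕ × ℤ) × ℕ) :=
  [([(1, 1), (3, 1), (5, 1), (15, 1)], 15)]

/-- **`dim S₂(Γ₀(15)) = g(X₀(15)) = 1`** (the named fact `finrank_cuspForm_two_eq_genusX0 15`,
Diamond–Shurman Thm. 3.5.1), from `1` `η`-quotient in `S₂(Γ₀(15))` with distinct orders at `∞`
(Newman–Ligozat criterion, certified by `decide`) and Manin's bound.
[cite: DiamondShurman2005, Thm. 3.5.1] -/
theorem finrank_cuspForm_two_eq_genusX0_fifteen :
    finrank_cuspForm_two_eq_genusX0 15 ∧ Module.finrank ℂ (CuspForm (Gamma0 15) 2) = 1 :=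
  finrank_eq_genusX0_of_etaCerts 15 etaCertsFifteen (by decide) (by decide) genusX0_fifteen

/-- The `η`-quotient certificates at level `24` (exponent lists with the square-root witness),
of orders `1` at `∞`. [folklore] -/
def etaCertsTwentyFour : List (List (ℕ × ℤ) × ℕ) :=
  [([(2, 1), (4, 1), (6, 1), (12, 1)], 24)]

/-- **`dim S₂(Γ₀(24)) = g(X₀(24)) = 1`** (the named fact `finrank_cuspForm_two_eq_genusX0 24`,
Diamond–Shurman Thm. 3.5.1), from `1` `η`-quotient in `S₂(Γ₀(24))` with distinct orders at `∞`
(Newman–Ligozat criterion, certified by `decide`) and Manin's bound.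
[cite: DiamondShurman2005, Thm. 3.5.1] -/
theorem finrank_cuspForm_two_eq_genusX0_twentyFour :
    finrank_cuspForm_two_eq_genusX0 24 ∧ Module.finrank ℂ (CuspForm (Gamma0 24) 2) = 1 :=
  finrank_eq_genusX0_of_etaCerts 24 etaCertsTwentyFour (by decide) (by decide) genusX0_twentyFour

/-- The `η`-quotient certificates at level `28` (exponent lists with the square-root witness),
of orders `1, 2` at `∞`. [folklore] -/
def etaCertsTwentyEight : List (List (ℕ × ℤ) × ℕ) :=
  [([(1, 1), (2, 1), (7, 1), (14, 1)], 14),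
   ([(2, 1), (4, 1), (14, 1), (28, 1)], 56)]

/-- **`dim S₂(Γ₀(28)) = g(X₀(28)) = 2`** (the named fact `finrank_cuspForm_two_eq_genusX0 28`,
Diamond–Shurman Thm. 3.5.1), from `2` `η`-quotients in `S₂(Γ₀(28))` with distinct orders at `∞`
(Newman–Ligozat criterion, certified by `decide`) and Manin's bound.
[cite: DiamondShurman2005, Thm. 3.5.1] -/
theorem finrank_cuspForm_two_eq_genusX0_twentyEight :
    finrank_cuspForm_two_eq_genusX0 28 ∧ Module.finrank ℂ (CuspForm (Gamma0 28) 2) = 2 :=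
  finrank_eq_genusX0_of_etaCerts 28 etaCertsTwentyEight (by decide) (by decide) genusX0_twentyEight

/-- The `η`-quotient certificates at level `30` (exponent lists with the square-root witness),
of orders `1, 2, 3` at `∞`. [folklore] -/
def etaCertsThirty : List (List (ℕ × ℤ) × ℕ) :=
  [([(3, 1), (5, 1), (6, 1), (10, 1)], 30),
   ([(2, 1), (6, 1), (10, 1), (30, 1)], 60),
   ([(1, -1), (2, 3), (3, 1), (5, 1), (6, -1), (10, -1), (15, -1), (30, 3)], 54000)]

/-- **`dim S₂(Γ₀(30)) = g(X₀(30)) = 3`** (the named fact `finrank_cuspForm_two_eq_genusX0 30`,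
Diamond–Shurman Thm. 3.5.1), from `3` `η`-quotients in `S₂(Γ₀(30))` with distinct orders at `∞`
(Newman–Ligozat criterion, certified by `decide`) and Manin's bound.
[cite: DiamondShurman2005, Thm. 3.5.1] -/
theorem finrank_cuspForm_two_eq_genusX0_thirty :
    finrank_cuspForm_two_eq_genusX0 30 ∧ Module.finrank ℂ (CuspForm (Gamma0 30) 2) = 3 :=
  finrank_eq_genusX0_of_etaCerts 30 etaCertsThirty (by decide) (by decide) genusX0_thirty

/-- The `η`-quotient certificates at level `33` (exponent lists with the square-root witness),
of orders `1, 2, 3` at `∞`. [folklore] -/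
def etaCertsThirtyThree : List (List (ℕ × ℤ) × ℕ) :=
  [([(1, 2), (11, 2)], 11),
   ([(1, 1), (3, 1), (11, 1), (33, 1)], 33),
   ([(3, 2), (33, 2)], 99)]

/-- **`dim S₂(Γ₀(33)) = g(X₀(33)) = 3`** (the named fact `finrank_cuspForm_two_eq_genusX0 33`,
Diamond–Shurman Thm. 3.5.1), from `3` `η`-quotients in `S₂(Γ₀(33))` with distinct orders at `∞`
(Newman–Ligozat criterion, certified by `decide`) and Manin's bound.
[cite: DiamondShurman2005, Thm. 3.5.1] -/
theorem finrank_cuspForm_two_eq_genusX0_thirtyThree :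
    finrank_cuspForm_two_eq_genusX0 33 ∧ Module.finrank ℂ (CuspForm (Gamma0 33) 2) = 3 :=
  finrank_eq_genusX0_of_etaCerts 33 etaCertsThirtyThree (by decide) (by decide) genusX0_thirtyThree

/-- The `η`-quotient certificates at level `35` (exponent lists with the square-root witness),
of orders `1, 2, 3` at `∞`. [folklore] -/
def etaCertsThirtyFive : List (List (ℕ × ℤ) × ℕ) :=
  [([(5, 2), (7, 2)], 35),
   ([(1, 1), (5, 1), (7, 1), (35, 1)], 35),
   ([(1, 2), (35, 2)], 35)]

/-- **`dim S₂(Γ₀(35)) = g(X₀(35)) = 3`** (the named fact `finrank_cuspForm_two_eq_genusX0 35`,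
Diamond–Shurman Thm. 3.5.1), from `3` `η`-quotients in `S₂(Γ₀(35))` with distinct orders at `∞`
(Newman–Ligozat criterion, certified by `decide`) and Manin's bound.
[cite: DiamondShurman2005, Thm. 3.5.1] -/
theorem finrank_cuspForm_two_eq_genusX0_thirtyFive :
    finrank_cuspForm_two_eq_genusX0 35 ∧ Module.finrank ℂ (CuspForm (Gamma0 35) 2) = 3 :=
  finrank_eq_genusX0_of_etaCerts 35 etaCertsThirtyFive (by decide) (by decide) genusX0_thirtyFive

/-- The `η`-quotient certificates at level `46` (exponent lists with the square-root witness),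
of orders `1, 2, 3, 4, 5` at `∞`. [folklore] -/
def etaCertsFortySix : List (List (ℕ × ℤ) × ℕ) :=
  [([(1, 3), (2, -1), (23, 3), (46, -1)], 1058),
   ([(1, 2), (23, 2)], 23),
   ([(1, 1), (2, 1), (23, 1), (46, 1)], 46),
   ([(2, 2), (46, 2)], 92),
   ([(1, -1), (2, 3), (23, -1), (46, 3)], 4232)]

/-- **`dim S₂(Γ₀(46)) = g(X₀(46)) = 5`** (the named fact `finrank_cuspForm_two_eq_genusX0 46`,
Diamond–Shurman Thm. 3.5.1), from `5` `η`-quotients in `S₂(Γ₀(46))` with distinct orders at `∞`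
(Newman–Ligozat criterion, certified by `decide`) and Manin's bound.
[cite: DiamondShurman2005, Thm. 3.5.1] -/
theorem finrank_cuspForm_two_eq_genusX0_fortySix :
    finrank_cuspForm_two_eq_genusX0 46 ∧ Module.finrank ℂ (CuspForm (Gamma0 46) 2) = 5 :=
  finrank_eq_genusX0_of_etaCerts 46 etaCertsFortySix (by decide) (by decide) genusX0_fortySix

/-- The `η`-quotient certificates at level `54` (exponent lists with the square-root witness),
of orders `1, 2, 4, 5` at `∞`. [folklore] -/
def etaCertsFiftyFour : List (List (ℕ × ℤ) × ℕ) :=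
  [([(3, 2), (9, 2)], 27),
   ([(6, 2), (18, 2)], 108),
   ([(6, 1), (9, 3), (18, -1), (27, -1), (54, 2)], 78732),
   ([(3, 1), (18, 2), (27, -1), (54, 2)], 8748)]

/-- **`dim S₂(Γ₀(54)) = g(X₀(54)) = 4`** (the named fact `finrank_cuspForm_two_eq_genusX0 54`,
Diamond–Shurman Thm. 3.5.1), from `4` `η`-quotients in `S₂(Γ₀(54))` with distinct orders at `∞`
(Newman–Ligozat criterion, certified by `decide`) and Manin's bound.
[cite: DiamondShurman2005, Thm. 3.5.1] -/
theorem finrank_cuspForm_two_eq_genusX0_fiftyFour :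
    finrank_cuspForm_two_eq_genusX0 54 ∧ Module.finrank ℂ (CuspForm (Gamma0 54) 2) = 4 :=
  finrank_eq_genusX0_of_etaCerts 54 etaCertsFiftyFour (by decide) (by decide) genusX0_fiftyFour

/-- The `η`-quotient certificates at level `64` (exponent lists with the square-root witness),
of orders `1, 2, 5` at `∞`. [folklore] -/
def etaCertsSixtyFour : List (List (ℕ × ℤ) × ℕ) :=
  [([(4, 2), (8, 2)], 32),
   ([(8, 2), (16, 2)], 128),
   ([(8, 3), (32, -1), (64, 2)], 8192)]

/-- **`dim S₂(Γ₀(64)) = g(X₀(64)) = 3`** (the named fact `finrank_cuspForm_two_eq_genusX0 64`,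
Diamond–Shurman Thm. 3.5.1), from `3` `η`-quotients in `S₂(Γ₀(64))` with distinct orders at `∞`
(Newman–Ligozat criterion, certified by `decide`) and Manin's bound.
[cite: DiamondShurman2005, Thm. 3.5.1] -/
theorem finrank_cuspForm_two_eq_genusX0_sixtyFour :
    finrank_cuspForm_two_eq_genusX0 64 ∧ Module.finrank ℂ (CuspForm (Gamma0 64) 2) = 3 :=
  finrank_eq_genusX0_of_etaCerts 64 etaCertsSixtyFour (by decide) (by decide) genusX0_sixtyFour

/-! ### The new list of levels -/

/-- **`dim S₂(Γ₀(N)) = g(X₀(N))` (the named fact `finrank_cuspForm_two_eq_genusX0 N`,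
Diamond–Shurman Thm. 3.5.1) for the ten `η`-quotient levels
`N ∈ {14, 15, 24, 28, 30, 33, 35, 46, 54, 64}`** of this file
(genera `1, 1, 1, 2, 3, 3, 3, 5, 4, 3`).
(Binder repair 2026-08-20, following `ModularCurve.finrank_cuspForm_two_eq_genusX0`'s of 2026-08-17:
the fact now takes `[NeZero N]` as a parameter, so this case split must carry it too; at each listed
level the instance is the numeral's.) [cite: DiamondShurman2005, Thm. 3.5.1] -/
theorem finrank_cuspForm_two_eq_genusX0_of_mem_etaLevels {N : ℕ} [NeZero N]
    (hN : N ∈ ({14, 15, 24, 28, 30, 33, 35, 46, 54, 64} : Finset ℕ)) :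
    finrank_cuspForm_two_eq_genusX0 N := by
  simp only [Finset.mem_insert, Finset.mem_singleton] at hN
  rcases hN with rfl | rfl | rfl | rfl | rfl | rfl | rfl | rfl | rfl | rfl
  · exact finrank_cuspForm_two_eq_genusX0_fourteen.1
  · exact finrank_cuspForm_two_eq_genusX0_fifteen.1
  · exact finrank_cuspForm_two_eq_genusX0_twentyFour.1
  · exact finrank_cuspForm_two_eq_genusX0_twentyEight.1
  · exact finrank_cuspForm_two_eq_genusX0_thirty.1
  · exact finrank_cuspForm_two_eq_genusX0_thirtyThree.1
  · exact finrank_cuspForm_two_eq_genusX0_thirtyFive.1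
  · exact finrank_cuspForm_two_eq_genusX0_fortySix.1
  · exact finrank_cuspForm_two_eq_genusX0_fiftyFour.1
  · exact finrank_cuspForm_two_eq_genusX0_sixtyFour.1

/-- **All levels at which `dim S₂(Γ₀(N)) = g(X₀(N))` is now proved unconditionally**:
`N ∈ {1, …, 16, 18, 20, 22, 23, 24, 25, 27, 28, 30, 32, 33, 35, 36, 46, 54, 64}` — the levels of
`ModularCurveGenusTwoProofs` together with the `η`-quotient levels of this file; in particular
every `N ≤ 16`. [cite: DiamondShurman2005, Thm. 3.5.1] -/
theorem finrank_cuspForm_two_eq_genusX0_of_mem_levels₂ {N : ℕ} [NeZero N]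
    (hN : N ∈ ({1, 2, 3, 4, 5, 6, 7, 8, 9, 10, 11, 12, 13, 14, 15, 16, 18, 20, 22, 23, 24, 25, 27,
      28, 30, 32, 33, 35, 36, 46, 54, 64} : Finset ℕ)) :
    finrank_cuspForm_two_eq_genusX0 N := by
  by_cases h : N ∈ ({14, 15, 24, 28, 30, 33, 35, 46, 54, 64} : Finset ℕ)
  · exact finrank_cuspForm_two_eq_genusX0_of_mem_etaLevels h
  · refine finrank_cuspForm_two_eq_genusX0_of_mem_levels (N := N) ?_
    simp only [Finset.mem_insert, Finset.mem_singleton] at hN h ⊢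
    omega

/-- `dim S₂(Γ₀(N)) = g(X₀(N))` for every `1 ≤ N ≤ 16`. [cite: DiamondShurman2005, Thm. 3.5.1] -/
theorem finrank_cuspForm_two_eq_genusX0_of_le_sixteen {N : ℕ} [NeZero N] (hN : N ≤ 16) :
    finrank_cuspForm_two_eq_genusX0 N := by
  refine finrank_cuspForm_two_eq_genusX0_of_mem_levels₂ (N := N) ?_
  have h0 : N ≠ 0 := NeZero.ne N
  simp only [Finset.mem_insert, Finset.mem_singleton]
  omega

/-- **The genus-cum-dimension formula `twelve_mul_finrank_cuspForm_two (Γ₀(N))`** (the named fact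
of `ModularCurveProofs`, Diamond–Shurman Thm. 3.1.1 with 3.5.1) at all these levels.
[cite: DiamondShurman2005, Thm. 3.1.1] -/
theorem twelve_mul_finrank_cuspForm_two_gamma0_of_mem_levels₂ {N : ℕ} [NeZero N]
    (hN : N ∈ ({1, 2, 3, 4, 5, 6, 7, 8, 9, 10, 11, 12, 13, 14, 15, 16, 18, 20, 22, 23, 24, 25, 27,
      28, 30, 32, 33, 35, 36, 46, 54, 64} : Finset ℕ)) :
    twelve_mul_finrank_cuspForm_two (Gamma0 N) :=
  (twelve_mul_finrank_cuspForm_two_gamma0_iff N).mpr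
    (finrank_cuspForm_two_eq_genusX0_of_mem_levels₂ hN)

/-- **`Ω⁺_f > 0` and `Ω⁻_f > 0` for rational newforms of all these levels, given
conjugation-stability** — the Eichler–Shimura-lattice chain of `ModularSymbolsManin` with its
dimension hypothesis discharged; newly meaningful at the conductors `14, 15, 24` (`X₀(14)`,
`X₀(15)`, `X₀(24)` are the elliptic curves `14a, 15a, 24a`) and `28, 30, 33, 35, 46, 54, 64`.
[cite: CremonaAlgorithms1997, §2.8] -/
theorem IsNewform0.plusPeriod_pos_and_minusPeriod_pos_of_mem_levels₂ {N : ℕ} [NeZero N]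
    (hN : N ∈ ({1, 2, 3, 4, 5, 6, 7, 8, 9, 10, 11, 12, 13, 14, 15, 16, 18, 20, 22, 23, 24, 25, 27,
      28, 30, 32, 33, 35, 36, 46, 54, 64} : Finset ℕ)) {f : CuspForm (Gamma0 N) 2}
    (H₂ : conj_mem_periodLattice (f := f)) :
    IsNewform0.plusPeriod_pos (f := f) ∧ IsNewform0.minusPeriod_pos (f := f) :=
  IsNewform0.plusPeriod_pos_and_minusPeriod_pos_of_genusX0_le N
    ((finrank_cuspForm_two_eq_genusX0_iff_le N).mp
      (finrank_cuspForm_two_eq_genusX0_of_mem_levels₂ hN)) H₂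


/-! ### The weight-2 newforms of levels `14`, `15`, `24` as `η`-products -/

/-- The exponent list of `η(τ)η(2τ)η(7τ)η(14τ)`. [folklore] -/
def etaList14 : List (ℕ × ℤ) := [(1, 1), (2, 1), (7, 1), (14, 1)]

/-- The exponent list of `η(τ)η(3τ)η(5τ)η(15τ)`. [folklore] -/
def etaList15 : List (ℕ × ℤ) := [(1, 1), (3, 1), (5, 1), (15, 1)]

/-- The exponent list of `η(2τ)η(4τ)η(6τ)η(12τ)`. [folklore] -/
def etaList24 : List (ℕ × ℤ) := [(2, 1), (4, 1), (6, 1), (12, 1)]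

/-- The certificates of the three `η`-products. [folklore] -/
theorem etaCert_14_15_24 :
    EtaCert 14 etaList14 14 ∧ EtaCert 15 etaList15 15 ∧ EtaCert 24 etaList24 24 := by
  decide

/-- **`f₁₄ = η(τ)η(2τ)η(7τ)η(14τ) ∈ S₂(Γ₀(14))`** (the newform of the elliptic curve `14a`, i.e.
of `X₀(14)` itself). [folklore] -/
def cuspFormEta14 : CuspForm (Gamma0 14) 2 :=
  etaQuotientCuspForm 14 (expFn etaList14) 2 (by decide)
    (newmanCond_of_etaCert etaCert_14_15_24.1) etaCert_14_15_24.1.2.2.2.2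

/-- **`f₁₅ = η(τ)η(3τ)η(5τ)η(15τ) ∈ S₂(Γ₀(15))`** (the newform of `15a = X₀(15)`). [folklore] -/
def cuspFormEta15 : CuspForm (Gamma0 15) 2 :=
  etaQuotientCuspForm 15 (expFn etaList15) 2 (by decide)
    (newmanCond_of_etaCert etaCert_14_15_24.2.1) etaCert_14_15_24.2.1.2.2.2.2

/-- **`f₂₄ = η(2τ)η(4τ)η(6τ)η(12τ) ∈ S₂(Γ₀(24))`** (the newform of `24a = X₀(24)`). [folklore] -/
def cuspFormEta24 : CuspForm (Gamma0 24) 2 :=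
  etaQuotientCuspForm 24 (expFn etaList24) 2 (by decide)
    (newmanCond_of_etaCert etaCert_14_15_24.2.2) etaCert_14_15_24.2.2.2.2.2.2

/-- The underlying functions. [folklore] -/
theorem coe_cuspFormEta_14_15_24 :
    (cuspFormEta14 : ℍ → ℂ) = etaQuotient 14 (expFn etaList14) ∧
      (cuspFormEta15 : ℍ → ℂ) = etaQuotient 15 (expFn etaList15) ∧
      (cuspFormEta24 : ℍ → ℂ) = etaQuotient 24 (expFn etaList24) := ⟨rfl, rfl, rfl⟩

/-- An `η`-quotient cusp form is nonzero. [folklore] -/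
theorem etaQuotientCuspForm_ne_zero (N : ℕ) [NeZero N] (r : ℕ → ℤ) (k : ℤ) (hkeven : Even k)
    (hc : NewmanCond N r k) (hord : ∀ t ∈ N.divisors, 0 < cuspOrder24 N r t) :
    etaQuotientCuspForm N r k hkeven hc hord ≠ 0 := by
  intro h
  have := congrArg (fun f : CuspForm (Gamma0 N) k ↦ f UpperHalfPlane.I) h
  simp only [CuspForm.zero_apply] at this
  exact etaQuotient_ne_zero N r UpperHalfPlane.I this

/-- **`S₂(Γ₀(14)) = ℂ f₁₄`, `S₂(Γ₀(15)) = ℂ f₁₅`, `S₂(Γ₀(24)) = ℂ f₂₄`.**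
[cite: DiamondShurman2005, Thm. 3.5.1] -/
theorem cuspForm_two_eq_smul_eta_14_15_24 :
    (∀ f : CuspForm (Gamma0 14) 2, ∃ c : ℂ, c • cuspFormEta14 = f) ∧
      (∀ f : CuspForm (Gamma0 15) 2, ∃ c : ℂ, c • cuspFormEta15 = f) ∧
      (∀ f : CuspForm (Gamma0 24) 2, ∃ c : ℂ, c • cuspFormEta24 = f) :=
  ⟨(finrank_cuspForm_two_eq_genusX0_of_genusX0_eq_one 14 genusX0_fourteen
      (etaQuotientCuspForm_ne_zero _ _ _ _ _ _)).2,
    (finrank_cuspForm_two_eq_genusX0_of_genusX0_eq_one 15 genusX0_fifteen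
      (etaQuotientCuspForm_ne_zero _ _ _ _ _ _)).2,
    (finrank_cuspForm_two_eq_genusX0_of_genusX0_eq_one 24 genusX0_twentyFour
      (etaQuotientCuspForm_ne_zero _ _ _ _ _ _)).2⟩

end Literature.NumberTheory.EllipticCurves.ModularForms
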